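/-
Copyright: statement-level skeleton of a published paper (lit-balaban cell, Phase-2 proof seat p13, gen 5). No proof
claims beyond what the kernel checks below.
-/
import Literature.MathematicalPhysics.QuantumFieldTheory.BalabanImbrieJaffe1984to88.BIJ88Eq242Lattice
import Literature.MathematicalPhysics.QuantumFieldTheory.Balaban1983to89.B4Sect5WalkDecay
import Literature.MathematicalPhysics.QuantumFieldTheory.BalabanImbrieJaffe1984to88.BIJ88WalkGeometry246

/-!
# `BalabanImbrieJaffe1984to88.BIJ88Ineq246Lattice` — T. Bałaban, J. Imbrie, A. Jaffe, *Effective action and cluster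
properties of the abelian Higgs model*, Commun. Math. Phys. **114** (1988) 257–315 [BalabanImbrieJaffe1988], §2
pp. 264–265 [PDF 8–9]: the bounds **(2.46)** `|C^{(k)}_{Λ,X}(u;x₁,x₂)| ≦ e^{−cr(e_k)|X|}` and **(2.47)**
`|C^{(k)}_{Λ,loc}(u;x₁,x₂) − C^{(k)}_Λ(u;x₁,x₂)| ≦ e^{−cr(e_k)}e^{−c|x₁−x₂|}` (the tail of the primed sum (2.43)) PROVED FOR THE
`ℤ^d` OPERATORS OF [6] = [Balaban1983RegularityDecay] Sect. 5 — the walk-kernel hypotheses of the «[6]-setting» files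
`…BIJ88Ineq246Walks` / `…BIJ88Ineq247Walks` (seat p36) DISCHARGED for the actual walk terms `BIJ88Eq242Lattice.latticeCw`

statement-level skeleton of published theorems with citation tags; proofs where landed; nothing here is a claim
about the Yang–Mills mass gap

PDF held: `paper:balaban1988-cmp114-bij-abelian-higgs-effective-action` (journal page = PDF page + 256; pp. 264–265
read with `lit read … --pages 8-9`); [6]: `paper:balaban1983-cmp89-regularity-decay` pp. 594–596 [PDF 24–26] (renders
`run/shared/lean/pub/pub-balaban/b2b-balaban-ref1/pages/1983-cmp89-regularity-decay/…-p025/026-x2.png`).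

CITATION HEADER (lean-in-tree rule).  lit-balaban cell (HOME `run/shared/lean/pub/lit-balaban/`), Phase 2, seat p13
gen 5 (unit `lit-balaban-p13-g5`); rows **C2.Eq2.43 / C2.Eq2.46 / C2.Eq2.47** of `HOME/lit-balaban-r18/ROWS-C2.md`
(owner r18, referee ref-5).  Files USED BY NAME, nothing restated: this seat's `…BIJ88RandomWalk242` (p244240: `Walk`,
`Near`, `cLoc`, `cubesMet`, `closure`, `region`, `cX`, `memX`, `cX_support`, `ineq246_of_bound`, `eq245_of_eq242`),
`…BIJ88Eq242Lattice` (p245766: `flatten`, `latticeCw`, `eq242_lattice`), `…B4Sect5WalkDecay` (p247099: the `L²` bounds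
`l2norm_aFac_le`, `sum_weight_bFac_le`, `walkTerm_apply_eq_zero_left/right`, `sum_indicator_inBox_le`,
`hasSum_walkTerm_apply`), `…B4Sect5CubeBounds` (p245229: the cube system on `ℤ^d`, `Adj`, `InBox`, `labels`,
`aFac_mul_bFac_eq_zero`, `bFac_mul_bFac_eq_zero`), and seat p36's `…BIJ88WalkGeometry246` (p245454's geometry:
`ptAt`, `mem_pts_iff`, `PairwiseFar`, `exists_far_subfamily`, `card_le_of_covered`).

## The print (verbatim, pp. 264–265)

*"and the convergence and locality properties of the random walk expansion imply the following facts about these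
operators. The local covariance C^{(k)}_{Λ,loc}(u; x₁, x₂) … is bounded as in (2.41). The operator C^{(k)}_{Λ,X}(u)
depends only on u in X. It vanishes unless both arguments are in X, and is estimated as follows:
|C^{(k)}_{Λ,X}(u; x₁, x₂)| ≦ e^{−cr(e_k)|X|}. (2.46)  Here and elsewhere, |X| refers to the number of r(e_k)-cubes in X,
not the volume of X. This estimate can be summed over all connected sets X to show that
|C^{(k)}_{Λ,loc}(u; x₁, x₂) − C^{(k)}_Λ(u; x₁, x₂)| ≦ e^{−cr(e_k)}e^{−c|x₁−x₂|}. (2.47)"* (the text layer garbles the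
display (2.47); it is quoted as read from the page image by seats p36 (`…BIJ88Ineq247Walks`) and p02
(`…BIJ88Close247Animals`) and as typed by r18: `BIJ88Sect2Statements.Close`).

## WHY A NEW MECHANISM (and what is proved)

The [6]-setting files take the walk terms `C_ω` as nearest-neighbour walks on the cube labels with a majorant
`A·βⁿ` (seat p36, `BIJ88Ineq246Walks` header: *«NOT here: the operators and the verification of these hypotheses for
the actual C^{(k)}_Λ(u)»*).  The `ℤ^d` walk terms of [6] (5.17) are NOT nearest-neighbour: the pair factor
`R_{j,j′}C_{j′}h_{j′}` is non-zero for distant `j, j′` and only exponentially small, `‖R_{j,j′}‖ ≤ αe^{−δ₂|j−j′|}`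
((5.15)).  The substitute is the PATH LENGTH of a walk in label units (sup-distance on `ℤ^d`):
* §1 `pathweighted_level_le` (abstract): with a per-pair weight `w(l₁,l′) ≥ 0` and
  `Σ_{(l₁,l′): l ~ l₁} w(l₁,l′)‖b(l₁,l′)‖ ≤ θ`, `Σ_{pairs} Π_i w(pair_i)·‖a·Πb‖ ≤ ‖a‖θⁿ` — the level estimate of
  `B4Sect5WalkDecay.weighted_level_exp_le` with MULTIPLICATIVE weights (no triangle inequality needed); with
  `w = e^{(δ₀/8)(1 + |l₁−l′|)}` the hypothesis is `B4Sect5WalkDecay.sum_weight_bFac_le` and `θ = θ_W(M)` of (5.21).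
* §2 (abstract timing with costs): along any label sequence, `d(ω_{t₁}, ω_{t₂}) ≤ P(t₂) − P(t₁)` for the cumulative
  path length `P` (`dist_ptAt_le_cost`), and a pairwise-far family of `m + 1` cubes (non-touching cubes `≥ s` apart
  in `P`) visited by time `T` forces `m·s ≤ P(T) − P(0)` (`far_family_le_cost` — p36's `far_family_le_length` with
  time replaced by path length).
* §3 the `ℤ^d` walks: a contributing tuple is a CHAIN (`isChain_of_term_ne_zero`: non-adjacent consecutive labels
  kill the term, (5.17) locality), and for chains the path length of the flattened label sequence is at most
  `plen = Σ_i(1 + |ω_{2i−1} − ω_{2i}|)` — what the weights pay (`pathCost_le_plen`).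
* §4 **THE TAIL BOUND** `abs_tsum_class_le`: for every class `S` of tuples whose contributing members have
  `plen ≥ L`, `Σ_{ω∈S}|C_ω(x₁,x₂)| ≤ 2^dγ₀^{−1}(1 − θ_W)^{−1}e^{−(δ₀/8)L}` (entries through `x₁ ∈ □_{ω₀}`: `2^d` starts).
* §5 **(2.47)/(2.43)**: with the label-to-site distance `ldist l x = M^{−1}|Ml − x|` and `ρ` (print: `¼r(e_k)`), a
  contributing NON-primed walk has path length `≥ ρ − 1` (it starts within `1` of `x₁` and ends within `1` of `x₂`),
  so `|C_{Λ,loc}(x₁,x₂) − A_Λ^{−1}(x₁,x₂)| ≤ 2^dγ₀^{−1}(1−θ_W)^{−1}e^{δ₀/8}e^{−(δ₀/8)ρ}` (`abs_cLoc_sub_inv_le`); it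
  also has path length `≥ M^{−1}|x₁ − x₂| − 2` (`sdist_le_plen_add_two`), whence the typed row
  `BIJ88Sect2Statements.Close sdist C_{Λ,loc} A_Λ^{−1} δ c`, `c = δ₀/16`, `δ = 2^dγ₀^{−1}(1−θ_W)^{−1}e^{−(δ₀/16)(ρ−3)}`
  (`close247_lattice`; the row's proof of record in [6]'s nearest-neighbour setting is p36's
  `BIJ88Ineq247Walks.close247`).
* §6 **(2.46)**: `r(e_k)`-cubes = cubes of `s` labels a side (`cubeOf`, `s ≥ 1`), touching/adjacency = sup-distance
  `≤ 1` of cube labels (`≤ 3^d` neighbours), non-touching cubes are `> s` label units apart; a contributing walk of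
  the class `X` (region = closure of the cubes met = `X`, reading R1 of `BIJ88RandomWalk242`) meets `≥ |X|/3^d` cubes,
  among them a pairwise-far family of `≥ |X|/9^d`, so its path length is `≥ s(|X|/9^d − 1)`, and, being non-primed,
  also `≥ ρ − 1`; with `ρ = s/4`: `plen ≥ (s/8)(|X|/9^d) − 1`.  Hence `|C_{Λ,X}(x₁,x₂)| ≤ K₀·e^{−(δ₀s/(64·9^d))|X|}`,
  `K₀ = 2^dγ₀^{−1}(1−θ_W)^{−1}e^{δ₀/8}` (`abs_cX_lattice_le`), END-POINT LOCALITY discharged (`latticeCw_support`),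
  and the typed row `BIJ88Sect2Statements.Ineq246` for the lattice data in the printed form `e^{−c·r·|X|}`,
  `r = s` (label units; `= r(e_k)/M`), `c = δ₀/(128·9^d)`, once `r` is large enough to absorb `K₀`
  (`ineq246_lattice`; p. 260: `r(e_k) = |log e_k⁻¹|^r → ∞`).
* §7 (v1.1, append-only) **(2.41)** *"|C^{(k)}_Λ(u; x₁, x₂)| ≦ ce^{−c|x₁−x₂|}"* and **(2.43)** *"The local covariance
  … is bounded as in (2.41)"* for the same operators: EVERY class of walks decays in the site distance
  (`abs_tsum_class_le_sdist`), so `|A_Λ^{−1}(x₁,x₂)| ≤ 2^dγ₀^{−1}(1−θ_W)^{−1}e^{δ₀/4}·e^{−(δ₀/8)·sdist(x₁,x₂)}`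
  through (2.42) (`abs_inv_lattice_le`) and the same bound for `C_{Λ,loc}` (`abs_cLoc_lattice_le`); the typed rows
  `BIJ88Sect2Statements.Decay sdist A_Λ^{−1} c` / `Decay sdist C_{Λ,loc} c` for every `c` with
  `2^dγ₀^{−1}(1−θ_W)^{−1}e^{δ₀/4} ≤ c ≤ δ₀/8` (`decay241_lattice`, `decay241_cLoc_lattice`; the one-letter shape
  forces this compatibility, as in p02's `BIJ88Decay241Walks.decay241` for [6]'s nearest-neighbour setting).
* §8 (v1.2, append-only) the same rows for the DIRICHLET RESTRICTIONS **(2.39)** `C^{(k)}_Λ = [A|_Λ]^{−1}`,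
  `Λ ⊆ Ω`, of an `A` on `L²(Ω; ℝ^N)` with (5.6), with the SAME constants ((5.6) passes to compressions,
  `B6GOmega.hyp56_compress`): `ineq246_compress`, `close247_compress`, `decay241_compress`,
  `decay241_cLoc_compress` (companions of `BIJ88Eq242Lattice.eq245_compress`).
HONEST SCOPE.  Everything is for the operators of [6] Sect. 5 on `L²(Λ; ℝ^N)`, `Λ ⊂ ℤ^d` finite, `A` with (5.6)
(`B4.Hyp56 Λ A γ₀ c₀ δ₀`), cubes `M ≥ 5`, `M > K_R`, `M > Θ₁` (expansion) and `θ_W(M) < 1` ((5.21)); distances in LABEL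
units (`1` label unit `= M` lattice units; the print's `r(e_k)` is `sM`, its `¼r(e_k)` is `ρM` with `ρ = s/4`); the
identification of `A` with the print's `Δ_{k,loc}(u) + aL^{−2}Q(u)*Q(u)` (whose (5.6) is (2.38) + [6] Lemma 2.1) is NOT
made here; constants explicit, not optimized.  No `sorry`; no new `Prop` fact.
-/

namespace Literature.MathematicalPhysics.QuantumFieldTheory.BalabanImbrieJaffe1984to88.BIJ88Ineq246Lattice

open scoped BigOperators
open Finset
open Literature.MathematicalPhysics.QuantumFieldTheory.Balaban1983to89
open Literature.MathematicalPhysics.QuantumFieldTheory.BalabanImbrieJaffe1984to88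
open B4RandomWalk213 B4Sect5RandomWalk B4Sect5CubeBounds B4Sect5Proof B4Sect5WalkDecay BIJ88RandomWalk242
  BIJ88WalkGeometry246 BIJ88Eq242Lattice

/-! ## §1 The level estimate with multiplicative path-length weights -/

section Abstract

variable {R : Type*} [NormedRing R] {J : Type*} [Fintype J]

/-- **PATH-LENGTH WEIGHTED LEVEL ESTIMATE** (the convergence mechanism of (2.42)/(2.46) for NON-nearest-neighbour
walk terms): pair factors `b(l₁,l′)` with the locality of [6] (5.17) (`hbb`) and a weighted successor bound
`Σ_{(l₁,l′): l ~ l₁} w(l₁,l′)‖b(l₁,l′)‖ ≤ θ` (`w ≥ 0`) give, for every left factor `x` ending at `l`,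
`Σ_{pairs} (Π_i w(pair_i))·‖x·b(pair₀)⋯b(pair_{n−1})‖ ≤ ‖x‖θⁿ`. [cite: BalabanImbrieJaffe1988, (2.46) p.264;
Balaban1983RegularityDecay, (5.18) p.595] -/
theorem pathweighted_level_le (adj : J → J → Prop) [DecidableRel adj] (w : J × J → ℝ) (hw : ∀ q, 0 ≤ w q)
    {b : J × J → R} {θ : ℝ}
    (hbb : ∀ q q' : J × J, ¬ adj q.2 q'.1 → b q * b q' = 0)
    (hθ : ∀ l : J, ∑ q ∈ Finset.univ.filter (fun q : J × J => adj l q.1), w q * ‖b q‖ ≤ θ) :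
    ∀ (n : ℕ) (l : J) (x : R), (∀ q : J × J, ¬ adj l q.1 → x * b q = 0) →
      ∑ ys : Fin n → J × J, (∏ i, w (ys i)) * ‖x * bprod b n ys‖ ≤ ‖x‖ * θ ^ n := by
  intro n
  induction n with
  | zero =>
      intro l x _
      simp
  | succ n ih =>
      intro l x hx
      have hθ0 : 0 ≤ θ := le_trans (Finset.sum_nonneg fun q _ => mul_nonneg (hw q) (norm_nonneg _)) (hθ l)
      rw [sum_tuple_succ]
      simp only [bprod_cons, Fin.prod_univ_succ, Fin.cons_zero, Fin.cons_succ]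
      calc ∑ q, ∑ ys : Fin n → J × J, w q * (∏ i, w (ys i)) * ‖x * (b q * bprod b n ys)‖
          = ∑ q, w q * ∑ ys : Fin n → J × J, (∏ i, w (ys i)) * ‖(x * b q) * bprod b n ys‖ := by
            refine Finset.sum_congr rfl fun q _ => ?_
            rw [Finset.mul_sum]
            refine Finset.sum_congr rfl fun ys _ => ?_
            rw [mul_assoc x]; ring
        _ ≤ ∑ q, w q * (‖x * b q‖ * θ ^ n) :=
            Finset.sum_le_sum fun q _ => mul_le_mul_of_nonneg_left
              (ih q.2 (x * b q) (fun q' hq' => by rw [mul_assoc, hbb q q' hq', mul_zero])) (hw q)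
        _ = ∑ q ∈ Finset.univ.filter (fun q : J × J => adj l q.1), w q * (‖x * b q‖ * θ ^ n) := by
            refine (Finset.sum_subset (Finset.subset_univ _) fun q _ hq => ?_).symm
            have hq' : ¬ adj l q.1 := fun h' => hq (Finset.mem_filter.mpr ⟨Finset.mem_univ q, h'⟩)
            rw [hx q hq', norm_zero, zero_mul, mul_zero]
        _ ≤ ∑ q ∈ Finset.univ.filter (fun q : J × J => adj l q.1), w q * (‖x‖ * ‖b q‖ * θ ^ n) :=
            Finset.sum_le_sum fun q _ => mul_le_mul_of_nonneg_left
              (mul_le_mul_of_nonneg_right (norm_mul_le _ _) (pow_nonneg hθ0 n)) (hw q)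
        _ = ‖x‖ * (∑ q ∈ Finset.univ.filter (fun q : J × J => adj l q.1), w q * ‖b q‖) * θ ^ n := by
            rw [Finset.mul_sum, Finset.sum_mul]
            refine Finset.sum_congr rfl fun q _ => ?_; ring
        _ ≤ ‖x‖ * θ * θ ^ n :=
            mul_le_mul_of_nonneg_right (mul_le_mul_of_nonneg_left (hθ l) (norm_nonneg _)) (pow_nonneg hθ0 n)
        _ = ‖x‖ * θ ^ (n + 1) := by ring

/-- if two CONSECUTIVE pair factors multiply to zero, the ordered product vanishes ((5.17): *"satisfying the
restrictions max_μ|ω_{2i,μ} − ω_{2i+1,μ}| ≤ 1"* — other tuples carry no term). [cite: Balaban1983RegularityDecay, (5.17) p.595] -/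
theorem bprod_eq_zero_of_consec {ι : Type*} (b : ι → R) :
    ∀ (n : ℕ) (ys : Fin n → ι) (k : ℕ) (hk : k + 1 < n),
      b (ys ⟨k, by omega⟩) * b (ys ⟨k + 1, hk⟩) = 0 → bprod b n ys = 0 := by
  intro n
  induction n with
  | zero => intro ys k hk; omega
  | succ n ih =>
      intro ys k hk h
      rw [bprod_succ]
      cases k with
      | zero =>
          obtain ⟨m, rfl⟩ : ∃ m, n = m + 1 := ⟨n - 1, by omega⟩
          rw [bprod_succ, ← mul_assoc]
          have h0 : b (ys 0) * b (Fin.tail ys 0) = 0 := by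
            have e1 : (Fin.tail ys 0) = ys ⟨0 + 1, hk⟩ := by
              simp only [Fin.tail]; congr 1
            rw [e1]; exact h
          rw [h0, zero_mul]
      | succ k =>
          have hk' : k + 1 < n := by omega
          have h' : b (Fin.tail ys ⟨k, by omega⟩) * b (Fin.tail ys ⟨k + 1, hk'⟩) = 0 := by
            have e1 : Fin.tail ys ⟨k, by omega⟩ = ys ⟨k + 1, by omega⟩ := by
              simp only [Fin.tail]; congr 1
            have e2 : Fin.tail ys ⟨k + 1, hk'⟩ = ys ⟨k + 1 + 1, hk⟩ := by
              simp only [Fin.tail]; congr 1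
            rw [e1, e2]; exact h
          rw [ih (Fin.tail ys) k hk' h', mul_zero]

end Abstract

/-! ## §2 Walks read in time with a path-length cost -/

section Timing

variable {ι κ : Type*}

/-- **PATH LENGTH DOMINATES DISPLACEMENT**: for a pseudo-distance `d` and any step costs `c t ≥ d(ω_t, ω_{t+1})`,
`d(ω_{t₁}, ω_{t₂}) ≤ Σ_{t₁ ≤ t < t₂} c t` — the path-length form of p36's «one unit per step» (`dist_ptAt_le`).
[cite: BalabanImbrieJaffe1988, (2.46) p.264] -/
theorem dist_ptAt_le_cost (d : ι → ι → ℝ) (hd0 : ∀ i, d i i = 0) (htri : ∀ i j l, d i l ≤ d i j + d j l)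
    {j : ι} {n : ℕ} {ys : Fin n → ι} (c : ℕ → ℝ)
    (hstep : ∀ t, t < n → d (ptAt j ys t) (ptAt j ys (t + 1)) ≤ c t) {t₁ t₂ : ℕ} (h12 : t₁ ≤ t₂) (h2 : t₂ ≤ n) :
    d (ptAt j ys t₁) (ptAt j ys t₂) ≤ ∑ k ∈ Finset.Ico t₁ t₂, c k := by
  obtain ⟨m, rfl⟩ := Nat.exists_eq_add_of_le h12
  clear h12
  induction m with
  | zero => simp [hd0]
  | succ m ih =>
      have hm : t₁ + m ≤ n := by omega
      calc d (ptAt j ys t₁) (ptAt j ys (t₁ + (m + 1)))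
          ≤ d (ptAt j ys t₁) (ptAt j ys (t₁ + m)) + d (ptAt j ys (t₁ + m)) (ptAt j ys (t₁ + m + 1)) := by
            rw [← Nat.add_assoc]; exact htri _ _ _
        _ ≤ ∑ k ∈ Finset.Ico t₁ (t₁ + m), c k + c (t₁ + m) := add_le_add (ih hm) (hstep _ (by omega))
        _ = ∑ k ∈ Finset.Ico t₁ (t₁ + (m + 1)), c k := by
            rw [← Nat.add_assoc, Finset.sum_Ico_succ_top (by omega : t₁ ≤ t₁ + m)]

/-- **FAR CUBES COST PATH LENGTH** (p36's `far_family_le_length` with time replaced by a monotone cumulative cost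
`P`): if non-touching cubes at times `t₁ ≤ t₂` are `≥ s` apart in `P` (`hsep`), a pairwise-far family of `m + 1`
cubes all visited by time `T` forces `m·s ≤ P(T) − P(0)`. [cite: BalabanImbrieJaffe1988, (2.46) p.264] -/
theorem far_family_le_cost {j : ι} {n : ℕ} {ys : Fin n → ι} (cube : ι → κ) (touch : κ → κ → Prop) (s : ℝ)
    (P : ℕ → ℝ) (hP : Monotone P)
    (hsep : ∀ t₁ t₂ : ℕ, t₁ ≤ t₂ → t₂ ≤ n →
      ¬ touch (cube (ptAt j ys t₁)) (cube (ptAt j ys t₂)) → s ≤ P t₂ - P t₁) :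
    ∀ (m : ℕ) (F : Finset κ), F.card = m + 1 → PairwiseFar touch F →
      ∀ T : ℕ, (∀ Q ∈ F, ∃ t, t ≤ T ∧ t ≤ n ∧ cube (ptAt j ys t) = Q) → (m : ℝ) * s ≤ P T - P 0 := by
  classical
  intro m
  induction m with
  | zero =>
      intro F _ _ T _
      simp only [Nat.cast_zero, zero_mul, sub_nonneg]
      exact hP (Nat.zero_le T)
  | succ m ih =>
      intro F hcard hfar T hvis
      choose! τ hτT hτn hτQ using hvis
      have hne : F.Nonempty := by rw [← Finset.card_pos, hcard]; omega
      obtain ⟨Qs, hQs, hmax⟩ := Finset.exists_max_image F τ hne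
      have hcard' : (F.erase Qs).card = m + 1 := by rw [Finset.card_erase_of_mem hQs, hcard]; rfl
      have hne' : (F.erase Qs).Nonempty := by rw [← Finset.card_pos, hcard']; omega
      obtain ⟨Q', hQ', hmax'⟩ := Finset.exists_max_image (F.erase Qs) τ hne'
      have hQ'F : Q' ∈ F := Finset.mem_of_mem_erase hQ'
      have hih : (m : ℝ) * s ≤ P (τ Q') - P 0 :=
        ih (F.erase Qs) hcard' (hfar.mono (Finset.erase_subset _ _)) (τ Q') fun Q hQ =>
          ⟨τ Q, hmax' Q hQ, hτn Q (Finset.mem_of_mem_erase hQ), hτQ Q (Finset.mem_of_mem_erase hQ)⟩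
      have hnt : ¬ touch (cube (ptAt j ys (τ Q'))) (cube (ptAt j ys (τ Qs))) := by
        rw [hτQ Q' hQ'F, hτQ Qs hQs]
        exact hfar Q' hQ'F Qs hQs (Finset.ne_of_mem_erase hQ')
      have hgap : s ≤ P (τ Qs) - P (τ Q') := hsep _ _ (hmax Q' hQ'F) (hτn Qs hQs) hnt
      have hT : P (τ Qs) ≤ P T := hP (hτT Qs hQs)
      push_cast
      linarith

end Timing

/-! ## §3 The `ℤ^d` walks of [6] (5.17): chains, path length, and the visited labels -/

section Lattice

open scoped Matrix.Norms.L2Operator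

variable {d N : ℕ} {Λ : Finset (Fin d → ℤ)} {γ₀ c₀ δ₀ : ℝ}

/-- the tuples `(n; ω₀; (ω₁,ω₂),…,(ω_{2n−1},ω_{2n}))` of [6] (5.17) over the cube labels of `Λ`.
[cite: Balaban1983RegularityDecay, (5.17) p.595] -/
abbrev LTup (M : ℕ) (Λ : Finset (Fin d → ℤ)) := Σ n : ℕ, ↥(labels M Λ) × (Fin n → ↥(labels M Λ) × ↥(labels M Λ))

/-- the sup-distance of two cube labels (in label units; `1` label unit `= M` lattice units). [cite: Balaban1983RegularityDecay, (5.11) p.594] -/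
def dL {M : ℕ} (l l' : ↥(labels M Λ)) : ℝ := dist (l.1 : Fin d → ℤ) (l'.1 : Fin d → ℤ)

/-- `dL` vanishes on the diagonal. [cite: Balaban1983RegularityDecay, (5.11) p.594] -/
theorem dL_self {M : ℕ} (l : ↥(labels M Λ)) : dL l l = 0 := dist_self _

/-- triangle inequality for `dL`. [cite: Balaban1983RegularityDecay, (5.11) p.594] -/
theorem dL_triangle {M : ℕ} (l l' l'' : ↥(labels M Λ)) : dL l l'' ≤ dL l l' + dL l' l'' := dist_triangle _ _ _

/-- `dL` is symmetric. [cite: Balaban1983RegularityDecay, (5.11) p.594] -/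
theorem dL_comm {M : ℕ} (l l' : ↥(labels M Λ)) : dL l l' = dL l' l := dist_comm _ _

/-- `dL ≥ 0`. [cite: Balaban1983RegularityDecay, (5.11) p.594] -/
theorem dL_nonneg {M : ℕ} (l l' : ↥(labels M Λ)) : 0 ≤ dL l l' := dist_nonneg

/-- the walk term of (5.17) on `L²(Λ; ℝ^N)` for the tuple `cc` (abbreviation of this file).
[cite: Balaban1983RegularityDecay, (5.17) p.595] -/
noncomputable def term (M : ℕ) (A : Matrix (B4.Idx Λ N) (B4.Idx Λ N) ℝ) (cc : LTup M Λ) :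
    Matrix (B4.Idx Λ N) (B4.Idx Λ N) ℝ :=
  walkTerm517 (aFac (hFam N M Λ) (cFam M A)) (bFac A (pFam N M Λ) (hFam N M Λ) (cFam M A)) cc

/-- `latticeCw` on a flattened tuple is `term`. [cite: BalabanImbrieJaffe1988, (2.42) p.264] -/
theorem latticeCw_flatten' (M : ℕ) (A : Matrix (B4.Idx Λ N) (B4.Idx Λ N) ℝ) (cc : LTup M Λ) :
    latticeCw M Λ N A (flatten cc) = term M A cc :=
  latticeCw_flatten M A cc

/-- what the weights of §1 pay for a tuple: `plen = Σ_i (1 + |ω_{2i−1} − ω_{2i}|)` (label units) — an upper bound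
for the label path length of a CHAIN (`pathCost_le_plen`). [cite: BalabanImbrieJaffe1988, (2.46) p.264] -/
noncomputable def plen {M : ℕ} (cc : LTup M Λ) : ℝ := ∑ i : Fin cc.1, (1 + dL (cc.2.2 i).1 (cc.2.2 i).2)

/-- the point `ω_t` (`t ≤ 2n`) of the flattened label sequence of a tuple. [cite: Balaban1983RegularityDecay, (5.17) p.595] -/
noncomputable def pt {M : ℕ} (cc : LTup M Λ) (t : ℕ) : ↥(labels M Λ) := ptAt cc.2.1 (flatten cc).steps t

/-- `ω_0 = ω₀`. [cite: Balaban1983RegularityDecay, (5.17) p.595] -/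
theorem pt_zero {M : ℕ} (cc : LTup M Λ) : pt cc 0 = cc.2.1 := ptAt_zero _ _

/-- `ω_{2i+1}` is the first label of the `i`-th pair. [cite: Balaban1983RegularityDecay, (5.17) p.595] -/
theorem pt_odd {M : ℕ} (cc : LTup M Λ) (i : Fin cc.1) : pt cc (2 * i.val + 1) = (cc.2.2 i).1 := by
  unfold pt
  have h := ptAt_succ cc.2.1 (flatten cc).steps ⟨2 * i.val, by show 2 * i.val < 2 * cc.1; omega⟩
  simp only at h
  rw [h]
  have e : ∀ (p : 2 * i.val / 2 < cc.1), (⟨2 * i.val / 2, p⟩ : Fin cc.1) = i := fun p => Fin.ext (by simp)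
  simp only [flatten, Nat.mul_mod_right, ↓reduceIte, e]

/-- `ω_{2i+2}` is the second label of the `i`-th pair. [cite: Balaban1983RegularityDecay, (5.17) p.595] -/
theorem pt_even_succ {M : ℕ} (cc : LTup M Λ) (i : Fin cc.1) : pt cc (2 * i.val + 2) = (cc.2.2 i).2 := by
  unfold pt
  have h := ptAt_succ cc.2.1 (flatten cc).steps ⟨2 * i.val + 1, by show 2 * i.val + 1 < 2 * cc.1; omega⟩
  simp only at h
  rw [h]
  have hne : ¬ ((2 * i.val + 1) % 2 = 0) := by omega
  have e : ∀ (p : (2 * i.val + 1) / 2 < cc.1), (⟨(2 * i.val + 1) / 2, p⟩ : Fin cc.1) = i :=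
    fun p => Fin.ext (by show (2 * i.val + 1) / 2 = i.val; omega)
  simp only [flatten, hne, ↓reduceIte, e]

/-- `ω_{2n}` is the walk's end label `Walk.last`. [cite: Balaban1983RegularityDecay, (5.17) p.595] -/
theorem pt_len {M : ℕ} (cc : LTup M Λ) : pt cc (2 * cc.1) = (flatten cc).last := by
  unfold pt Walk.last
  exact ptAt_length _ _

/-- `ω_{2n}` is [6]'s end-point `lastPt ω₀ n (second labels)`. [cite: Balaban1983RegularityDecay, (5.17) p.595] -/
theorem pt_len_eq_lastPt {M : ℕ} (cc : LTup M Λ) : pt cc (2 * cc.1) = lastPt cc.2.1 cc.1 (fun i => (cc.2.2 i).2) := by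
  obtain ⟨n, j, ys⟩ := cc
  cases n with
  | zero =>
      show pt ⟨0, j, ys⟩ (2 * 0) = lastPt j 0 _
      rw [mul_zero, pt_zero, lastPt_zero]
  | succ n =>
      rw [lastPt_succ]
      have h := pt_even_succ ⟨n + 1, j, ys⟩ (Fin.last n)
      simp only [Fin.val_last] at h
      have e : 2 * (n + 1) = 2 * n + 2 := by ring
      rw [e]; exact h

/-- the visited labels of the flattened walk are the points `ω_t`, `t ≤ 2n`. [cite: BalabanImbrieJaffe1988, (2.43) p.264] -/
theorem mem_pts_flatten_iff {M : ℕ} (cc : LTup M Λ) (l : ↥(labels M Λ)) :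
    l ∈ (flatten cc).pts ↔ ∃ t ≤ 2 * cc.1, pt cc t = l :=
  mem_pts_iff cc.2.1 (flatten cc).steps l

/-- the CHAIN condition of (5.17): `ω_{2i}` and `ω_{2i+1}` are adjacent labels for every `i < n`.
[cite: Balaban1983RegularityDecay, (5.17) p.595] -/
def IsChain {M : ℕ} (cc : LTup M Λ) : Prop := ∀ i : Fin cc.1, Adj (pt cc (2 * i.val)).1 (pt cc (2 * i.val + 1)).1

/-- `ω_{2(i+1)}` for `i + 1 < n`… : the even point `ω_{2i}` for `i ≥ 1` is the second label of the pair `i − 1`.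
[cite: Balaban1983RegularityDecay, (5.17) p.595] -/
theorem pt_even_of_pos {M : ℕ} (cc : LTup M Λ) (i : Fin cc.1) (hi : 0 < i.val) :
    pt cc (2 * i.val) = (cc.2.2 ⟨i.val - 1, by omega⟩).2 := by
  have h := pt_even_succ cc ⟨i.val - 1, by omega⟩
  have e : 2 * (i.val - 1) + 2 = 2 * i.val := by omega
  rw [e] at h
  exact h

/-- **A CONTRIBUTING TUPLE IS A CHAIN**: if `ω_{2i}`, `ω_{2i+1}` are not adjacent for some `i`, the walk term
vanishes (`h_{ω₀}…·R_{ω₁,ω₂}… = 0` by the support of `h` and `R`, [6] (5.17)). [cite: Balaban1983RegularityDecay, (5.17) p.595] -/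
theorem isChain_of_term_ne_zero {M : ℕ} (hM : 0 < M) (A : Matrix (B4.Idx Λ N) (B4.Idx Λ N) ℝ) (cc : LTup M Λ)
    (h : term M A cc ≠ 0) : IsChain cc := by
  intro i
  by_contra hna
  apply h
  obtain ⟨n, j, ys⟩ := cc
  unfold term walkTerm517
  simp only
  have hin : i.val < n := i.2
  by_cases hi : i.val = 0
  · -- the vertex factor meets the first pair
    have h0 : pt ⟨n, j, ys⟩ (2 * i.val) = j := by rw [hi, mul_zero, pt_zero]
    have h1 : pt ⟨n, j, ys⟩ (2 * i.val + 1) = (ys i).1 := pt_odd ⟨n, j, ys⟩ i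
    rw [h0, h1] at hna
    obtain ⟨m, rfl⟩ : ∃ m, n = m + 1 := ⟨n - 1, by omega⟩
    have hi0 : i = 0 := Fin.ext hi
    rw [hi0] at hna
    rw [bprod_succ, ← mul_assoc, aFac_mul_bFac_eq_zero hM A j (ys 0) hna, zero_mul]
  · -- two consecutive pair factors
    have hpos : 0 < i.val := Nat.pos_of_ne_zero hi
    have h0 := pt_even_of_pos ⟨n, j, ys⟩ i hpos
    have h1 : pt ⟨n, j, ys⟩ (2 * i.val + 1) = (ys i).1 := pt_odd ⟨n, j, ys⟩ i
    rw [h0, h1] at hna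
    simp only at hna
    have hk : i.val - 1 + 1 < n := by omega
    have hz := bFac_mul_bFac_eq_zero hM A (ys ⟨i.val - 1, by omega⟩) (ys ⟨i.val - 1 + 1, hk⟩)
      (by
        have e : (⟨i.val - 1 + 1, hk⟩ : Fin n) = i := Fin.ext (by simp only; omega)
        rw [e]; exact hna)
    rw [bprod_eq_zero_of_consec _ n ys (i.val - 1) hk hz, mul_zero]

/-- the label path length (cumulative true displacement) of the flattened walk up to time `t`.
[cite: BalabanImbrieJaffe1988, (2.46) p.264] -/
noncomputable def pathCost {M : ℕ} (cc : LTup M Λ) (t : ℕ) : ℝ :=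
  ∑ k ∈ Finset.range t, dL (pt cc k) (pt cc (k + 1))

/-- `pathCost` is monotone. [cite: BalabanImbrieJaffe1988, (2.46) p.264] -/
theorem pathCost_mono {M : ℕ} (cc : LTup M Λ) : Monotone (pathCost cc) := by
  intro t₁ t₂ h
  unfold pathCost
  exact Finset.sum_le_sum_of_subset_of_nonneg (Finset.range_mono h) fun k _ _ => dL_nonneg _ _

/-- `pathCost 0 = 0`. [cite: BalabanImbrieJaffe1988, (2.46) p.264] -/
theorem pathCost_zero {M : ℕ} (cc : LTup M Λ) : pathCost cc 0 = 0 := by simp [pathCost]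

/-- displacement is dominated by path length: `|ω_{t₁} − ω_{t₂}| ≤ pathCost t₂ − pathCost t₁`.
[cite: BalabanImbrieJaffe1988, (2.46) p.264] -/
theorem dL_pt_le_pathCost {M : ℕ} (cc : LTup M Λ) {t₁ t₂ : ℕ} (h12 : t₁ ≤ t₂) (h2 : t₂ ≤ 2 * cc.1) :
    dL (pt cc t₁) (pt cc t₂) ≤ pathCost cc t₂ - pathCost cc t₁ := by
  have h := dist_ptAt_le_cost (j := cc.2.1) (ys := (flatten cc).steps) dL dL_self dL_triangle
    (fun k => dL (pt cc k) (pt cc (k + 1))) (fun t _ => le_refl _) h12 (by simpa [flatten] using h2)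
  unfold pathCost
  rw [← Finset.sum_range_add_sum_Ico _ h12]
  unfold pt at h ⊢
  linarith

/-- a parity split of a sum over `range (2n)`. [folklore] -/
private theorem sum_range_two_mul (f : ℕ → ℝ) (n : ℕ) :
    ∑ k ∈ Finset.range (2 * n), f k = ∑ i ∈ Finset.range n, (f (2 * i) + f (2 * i + 1)) := by
  induction n with
  | zero => simp
  | succ n ih =>
      rw [show 2 * (n + 1) = 2 * n + 1 + 1 by ring, Finset.sum_range_succ, Finset.sum_range_succ, ih,
        Finset.sum_range_succ]
      ring

/-- **THE WEIGHTS PAY FOR THE PATH LENGTH**: for a chain, the label path length of the flattened walk is at most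
`plen = Σ_i(1 + |ω_{2i−1} − ω_{2i}|)` (adjacent steps cost `≤ 1` in the sup-distance). [cite: BalabanImbrieJaffe1988, (2.46) p.264] -/
theorem pathCost_le_plen {M : ℕ} (cc : LTup M Λ) (hc : IsChain cc) : pathCost cc (2 * cc.1) ≤ plen cc := by
  unfold pathCost plen
  rw [sum_range_two_mul, Finset.sum_range]
  refine Finset.sum_le_sum fun i _ => add_le_add ?_ (le_of_eq ?_)
  · exact dist_le_one_of_adj (hc i)
  · rw [pt_odd cc i, show 2 * (i : ℕ) + 1 + 1 = 2 * (i : ℕ) + 2 by ring, pt_even_succ cc i]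

/-- every visited label is within `plen` of the start: `|ω₀ − ω_t| ≤ plen` (chains). [cite: BalabanImbrieJaffe1988, (2.46) p.264] -/
theorem dL_start_le_plen {M : ℕ} (cc : LTup M Λ) (hc : IsChain cc) {l : ↥(labels M Λ)}
    (hl : l ∈ (flatten cc).pts) : dL cc.2.1 l ≤ plen cc := by
  obtain ⟨t, ht, rfl⟩ := (mem_pts_flatten_iff cc l).mp hl
  have h1 := dL_pt_le_pathCost cc (Nat.zero_le t) ht
  rw [pt_zero, pathCost_zero, sub_zero] at h1
  exact h1.trans ((pathCost_mono cc ht).trans (pathCost_le_plen cc hc))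

/-- every visited label is within `plen` of the end: `|ω_t − ω_{2n}| ≤ plen` (chains). [cite: BalabanImbrieJaffe1988, (2.46) p.264] -/
theorem dL_last_le_plen {M : ℕ} (cc : LTup M Λ) (hc : IsChain cc) {l : ↥(labels M Λ)}
    (hl : l ∈ (flatten cc).pts) : dL l (flatten cc).last ≤ plen cc := by
  obtain ⟨t, ht, rfl⟩ := (mem_pts_flatten_iff cc l).mp hl
  have h1 := dL_pt_le_pathCost cc ht (le_refl _)
  rw [pt_len] at h1
  have h2 : 0 ≤ pathCost cc t := by rw [← pathCost_zero cc]; exact pathCost_mono cc (Nat.zero_le t)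
  linarith [pathCost_le_plen cc hc]

/-! ## §4 The tail bound: a class of long walks contributes exponentially little -/

/-- the per-step constant `θ_W(M) = 3^dK_d(δ₀/8)e^{δ₀/8}α(M)γ₀^{−1}` of [6] (5.21) (the expansion converges when
`θ_W(M) < 1`; `B4Sect5WalkDecay.thetaW_le`: `θ_W(M) ≤ Θ_W/M`). [cite: Balaban1983RegularityDecay, (5.21) p.596] -/
noncomputable def thetaW (d N : ℕ) (γ₀ c₀ δ₀ : ℝ) (M : ℕ) : ℝ :=
  3 ^ d * (latticeConst d (δ₀ / 8) * (Real.exp (δ₀ / 8) * alpha515 d N c₀ δ₀ M * γ₀⁻¹))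

/-- `θ_W ≥ 0`. [cite: Balaban1983RegularityDecay, (5.21) p.596] -/
theorem thetaW_nonneg (hc : 0 ≤ c₀) (hδ : 0 < δ₀) (hγ : 0 < γ₀) (M : ℕ) : 0 ≤ thetaW d N γ₀ c₀ δ₀ M := by
  unfold thetaW
  have := alpha515_nonneg d N hc hδ M
  have := latticeConst_nonneg d (by positivity : (0:ℝ) ≤ δ₀ / 8)
  positivity

/-- an entry of a walk term through `x₁`: `|term(x₁,x₂)| ≤ 1[x₁ ∈ □_{ω₀}]·‖term‖` (left support (5.18) + entries are
bounded by the `L²` operator norm). [cite: Balaban1983RegularityDecay, (5.18) p.595] -/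
theorem abs_term_apply_le {M : ℕ} (hM : 0 < M) (A : Matrix (B4.Idx Λ N) (B4.Idx Λ N) ℝ) (cc : LTup M Λ)
    (p q : B4.Idx Λ N) :
    |term M A cc p q| ≤ (if InBox M cc.2.1.1 (p.1 : Fin d → ℤ) then 1 else 0) * ‖term M A cc‖ := by
  by_cases hz : term M A cc p q = 0
  · rw [hz, abs_zero]; positivity
  · have hp : hfun M cc.2.1.1 (p.1 : Fin d → ℤ) ≠ 0 := fun h => hz (walkTerm_apply_eq_zero_left A cc p q h)
    rw [if_pos (inBox_of_hfun_ne_zero hM hp), one_mul]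
    exact abs_entry_le_l2norm _ p q

/-- the weights of §1 pay `e^{(δ₀/8)·plen}`: `Π_i e^{(δ₀/8)(1 + |ω_{2i−1}−ω_{2i}|)} = e^{(δ₀/8)plen}`.
[cite: BalabanImbrieJaffe1988, (2.46) p.264] -/
theorem prod_weight_eq_exp_plen {M : ℕ} (cc : LTup M Λ) :
    ∏ i : Fin cc.1, Real.exp (δ₀ / 8 * (1 + dL (cc.2.2 i).1 (cc.2.2 i).2)) = Real.exp (δ₀ / 8 * plen cc) := by
  rw [plen, Finset.mul_sum, Real.exp_sum]

/-- **ONE LEVEL OF THE TAIL**: for a class `S` whose contributing members have `plen ≥ L`,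
`Σ_{(ω₀; pairs) ∈ S, level n} |term(x₁,x₂)| ≤ 2^d·γ₀^{−1}·e^{−(δ₀/8)L}·θ_W(M)ⁿ`. [cite: BalabanImbrieJaffe1988, (2.46) p.264] -/
theorem level_class_sum_le (hγ : 0 < γ₀) (hc : 0 ≤ c₀) (hδ : 0 < δ₀) {A : Matrix (B4.Idx Λ N) (B4.Idx Λ N) ℝ}
    (hA : B4.Hyp56 Λ A γ₀ c₀ δ₀) {M : ℕ} (hM : 5 ≤ M) (S : Set (LTup M Λ)) (L : ℝ) (n : ℕ) (p q : B4.Idx Λ N)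
    (hSL : ∀ cc ∈ S, term M A cc p q ≠ 0 → L ≤ plen cc) :
    ∑ c : ↥(labels M Λ) × (Fin n → ↥(labels M Λ) × ↥(labels M Λ)),
        |S.indicator (fun cc => term M A cc p q) ⟨n, c⟩|
      ≤ 2 ^ d * γ₀⁻¹ * Real.exp (-(δ₀ / 8 * L)) * thetaW d N γ₀ c₀ δ₀ M ^ n := by
  classical
  have hM0 : 0 < M := by omega
  set a := aFac (hFam N M Λ) (cFam M A) with ha
  set b := bFac A (pFam N M Λ) (hFam N M Λ) (cFam M A) with hb
  set θ := thetaW d N γ₀ c₀ δ₀ M with hθ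
  set w : ↥(labels M Λ) × ↥(labels M Λ) → ℝ := fun q => Real.exp (δ₀ / 8 * (1 + dL q.1 q.2)) with hw
  have hθ0 : 0 ≤ θ := thetaW_nonneg hc hδ hγ M
  have hE0 : 0 ≤ Real.exp (-(δ₀ / 8 * L)) := (Real.exp_pos _).le
  -- the path-weighted level estimate for each starting label
  have hlevel : ∀ j : ↥(labels M Λ),
      ∑ ys : Fin n → ↥(labels M Λ) × ↥(labels M Λ), (∏ i, w (ys i)) * ‖a j * bprod b n ys‖ ≤ ‖a j‖ * θ ^ n := by
    intro j
    have h := pathweighted_level_le (fun l l' : ↥(labels M Λ) => Adj l.1 l'.1) w (fun q => (Real.exp_pos _).le)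
      (fun q q' h => bFac_mul_bFac_eq_zero hM0 A q q' h) (sum_weight_bFac_le hγ hc hδ hA hM) n j (a j)
      (fun q h => aFac_mul_bFac_eq_zero hM0 A j q h)
    rw [hθ, thetaW]
    exact h
  -- pointwise: an `S`-member's entry costs `e^{-εL}·(weights)·‖term‖` through `x₁ ∈ □_{ω₀}`
  have hpt : ∀ (j : ↥(labels M Λ)) (ys : Fin n → ↥(labels M Λ) × ↥(labels M Λ)),
      |S.indicator (fun cc => term M A cc p q) ⟨n, j, ys⟩| ≤
        (if InBox M j.1 (p.1 : Fin d → ℤ) then (1 : ℝ) else 0) *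
          (Real.exp (-(δ₀ / 8 * L)) * ((∏ i, w (ys i)) * ‖a j * bprod b n ys‖)) := by
    intro j ys
    by_cases hmem : (⟨n, j, ys⟩ : LTup M Λ) ∈ S
    · rw [Set.indicator_of_mem hmem]
      by_cases hz : term M A ⟨n, j, ys⟩ p q = 0
      · rw [hz, abs_zero]; positivity
      · have hL := hSL _ hmem hz
        have h1 := abs_term_apply_le hM0 A ⟨n, j, ys⟩ p q
        have h2 : (1 : ℝ) ≤ Real.exp (-(δ₀ / 8 * L)) * ∏ i, w (ys i) := by
          have hp : ∏ i, w (ys i) = Real.exp (δ₀ / 8 * plen ⟨n, j, ys⟩) := prod_weight_eq_exp_plen ⟨n, j, ys⟩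
          rw [hp, ← Real.exp_add]
          apply Real.one_le_exp
          have : δ₀ / 8 * L ≤ δ₀ / 8 * plen ⟨n, j, ys⟩ := mul_le_mul_of_nonneg_left hL (by positivity)
          linarith
        have hterm : term M A ⟨n, j, ys⟩ = a j * bprod b n ys := rfl
        calc |term M A ⟨n, j, ys⟩ p q|
            ≤ (if InBox M j.1 (p.1 : Fin d → ℤ) then (1 : ℝ) else 0) * ‖term M A ⟨n, j, ys⟩‖ := h1
          _ ≤ (if InBox M j.1 (p.1 : Fin d → ℤ) then (1 : ℝ) else 0) *
                ((Real.exp (-(δ₀ / 8 * L)) * ∏ i, w (ys i)) * ‖term M A ⟨n, j, ys⟩‖) := by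
              refine mul_le_mul_of_nonneg_left ?_ (by positivity)
              exact le_mul_of_one_le_left (norm_nonneg _) h2
          _ = _ := by rw [hterm]; ring
    · rw [Set.indicator_of_notMem hmem, abs_zero]; positivity
  calc ∑ c : ↥(labels M Λ) × (Fin n → ↥(labels M Λ) × ↥(labels M Λ)),
        |S.indicator (fun cc => term M A cc p q) ⟨n, c⟩|
      = ∑ j : ↥(labels M Λ), ∑ ys : Fin n → ↥(labels M Λ) × ↥(labels M Λ),
          |S.indicator (fun cc => term M A cc p q) ⟨n, j, ys⟩| := Fintype.sum_prod_type _
    _ ≤ ∑ j : ↥(labels M Λ), ∑ ys : Fin n → ↥(labels M Λ) × ↥(labels M Λ),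
          (if InBox M j.1 (p.1 : Fin d → ℤ) then (1 : ℝ) else 0) *
            (Real.exp (-(δ₀ / 8 * L)) * ((∏ i, w (ys i)) * ‖a j * bprod b n ys‖)) :=
        Finset.sum_le_sum fun j _ => Finset.sum_le_sum fun ys _ => hpt j ys
    _ = ∑ j : ↥(labels M Λ), (if InBox M j.1 (p.1 : Fin d → ℤ) then (1 : ℝ) else 0) * Real.exp (-(δ₀ / 8 * L)) *
          ∑ ys : Fin n → ↥(labels M Λ) × ↥(labels M Λ), (∏ i, w (ys i)) * ‖a j * bprod b n ys‖ := by
        refine Finset.sum_congr rfl fun j _ => ?_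
        rw [Finset.mul_sum]
        refine Finset.sum_congr rfl fun ys _ => ?_; ring
    _ ≤ ∑ j : ↥(labels M Λ), (if InBox M j.1 (p.1 : Fin d → ℤ) then (1 : ℝ) else 0) * Real.exp (-(δ₀ / 8 * L)) *
          (γ₀⁻¹ * θ ^ n) := by
        refine Finset.sum_le_sum fun j _ => mul_le_mul_of_nonneg_left ?_ (by positivity)
        exact (hlevel j).trans (mul_le_mul_of_nonneg_right (l2norm_aFac_le hγ hc hδ hA M j) (pow_nonneg hθ0 n))
    _ = (∑ j : ↥(labels M Λ), (if InBox M j.1 (p.1 : Fin d → ℤ) then (1 : ℝ) else 0)) *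
          (Real.exp (-(δ₀ / 8 * L)) * (γ₀⁻¹ * θ ^ n)) := by
        rw [Finset.sum_mul]; refine Finset.sum_congr rfl fun j _ => ?_; ring
    _ ≤ 2 ^ d * (Real.exp (-(δ₀ / 8 * L)) * (γ₀⁻¹ * θ ^ n)) :=
        mul_le_mul_of_nonneg_right (sum_indicator_inBox_le hM0 _) (by positivity)
    _ = _ := by ring

/-- the walk terms' entries are summable over all tuples (the expansion (2.42)/(5.17) converges absolutely,
entrywise). [cite: BalabanImbrieJaffe1988, (2.42) p.264] -/
theorem summable_abs_term_apply (hγ : 0 < γ₀) (hc : 0 ≤ c₀) (hδ : 0 < δ₀) {A : Matrix (B4.Idx Λ N) (B4.Idx Λ N) ℝ}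
    (hA : B4.Hyp56 Λ A γ₀ c₀ δ₀) {M : ℕ} (hM : 5 ≤ M) (hMR : kR d N γ₀ c₀ δ₀ < M)
    (hMθ : thetaConst d N γ₀ c₀ δ₀ < M) (p q : B4.Idx Λ N) :
    Summable fun cc : LTup M Λ => |term M A cc p q| :=
  (hasSum_walkTerm_apply hγ hc hδ hA hM hMR hMθ p q).summable.abs

/-- a class sum of absolute entries is summable. [cite: BalabanImbrieJaffe1988, (2.42) p.264] -/
theorem summable_abs_indicator_term (hγ : 0 < γ₀) (hc : 0 ≤ c₀) (hδ : 0 < δ₀)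
    {A : Matrix (B4.Idx Λ N) (B4.Idx Λ N) ℝ} (hA : B4.Hyp56 Λ A γ₀ c₀ δ₀) {M : ℕ} (hM : 5 ≤ M)
    (hMR : kR d N γ₀ c₀ δ₀ < M) (hMθ : thetaConst d N γ₀ c₀ δ₀ < M) (S : Set (LTup M Λ)) (p q : B4.Idx Λ N) :
    Summable fun cc : LTup M Λ => |S.indicator (fun cc => term M A cc p q) cc| := by
  refine (summable_abs_term_apply hγ hc hδ hA hM hMR hMθ p q).of_nonneg_of_le (fun cc => abs_nonneg _) fun cc => ?_
  by_cases hmem : cc ∈ S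
  · rw [Set.indicator_of_mem hmem]
  · rw [Set.indicator_of_notMem hmem, abs_zero]; exact abs_nonneg _

/-- **THE TAIL BOUND**: for every class `S` of tuples whose contributing members have `plen ≥ L`,
`Σ_{ω ∈ S} |C_ω(x₁,x₂)| ≤ 2^dγ₀^{−1}(1 − θ_W(M))^{−1}·e^{−(δ₀/8)L}` — the «convergence and locality properties of the
random walk expansion» (p. 264) quantified for the `ℤ^d` walks of [6]. [cite: BalabanImbrieJaffe1988, (2.46) p.264] -/
theorem abs_tsum_class_le (hγ : 0 < γ₀) (hc : 0 ≤ c₀) (hδ : 0 < δ₀) {A : Matrix (B4.Idx Λ N) (B4.Idx Λ N) ℝ}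
    (hA : B4.Hyp56 Λ A γ₀ c₀ δ₀) {M : ℕ} (hM : 5 ≤ M) (hMR : kR d N γ₀ c₀ δ₀ < M)
    (hMθ : thetaConst d N γ₀ c₀ δ₀ < M) (hθW : thetaW d N γ₀ c₀ δ₀ M < 1) (S : Set (LTup M Λ)) (L : ℝ)
    (p q : B4.Idx Λ N) (hSL : ∀ cc ∈ S, term M A cc p q ≠ 0 → L ≤ plen cc) :
    ∑' cc : LTup M Λ, |S.indicator (fun cc => term M A cc p q) cc|
      ≤ 2 ^ d * γ₀⁻¹ * (1 - thetaW d N γ₀ c₀ δ₀ M)⁻¹ * Real.exp (-(δ₀ / 8 * L)) := by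
  set θ := thetaW d N γ₀ c₀ δ₀ M with hθ
  set C := 2 ^ d * γ₀⁻¹ * Real.exp (-(δ₀ / 8 * L)) with hC
  have hθ0 : 0 ≤ θ := thetaW_nonneg hc hδ hγ M
  set g := fun cc : LTup M Λ => |S.indicator (fun cc => term M A cc p q) cc| with hg
  have habs : Summable g := summable_abs_indicator_term hγ hc hδ hA hM hMR hMθ S p q
  have h2 : ∑' cc, g cc = ∑' n, ∑' c, g ⟨n, c⟩ :=
    Summable.tsum_sigma' (fun n => (hasSum_fintype _).summable) habs
  have h3 : ∀ n, ∑' c, g ⟨n, c⟩ ≤ C * θ ^ n := fun n => by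
    rw [tsum_fintype]; exact level_class_sum_le hγ hc hδ hA hM S L n p q hSL
  have h4 : Summable fun n => ∑' c, g ⟨n, c⟩ := habs.sigma
  have h5 : ∑' n, ∑' c, g ⟨n, c⟩ ≤ ∑' n : ℕ, C * θ ^ n :=
    Summable.tsum_le_tsum h3 h4 ((summable_geometric_of_lt_one hθ0 hθW).mul_left C)
  have h6 : ∑' n : ℕ, C * θ ^ n = C * (1 - θ)⁻¹ := by
    rw [tsum_mul_left, tsum_geometric_of_lt_one hθ0 hθW]
  calc ∑' cc, g cc = ∑' n, ∑' c, g ⟨n, c⟩ := h2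
    _ ≤ C * (1 - θ)⁻¹ := h5.trans_eq h6
    _ = _ := by rw [hC]; ring

/-- transport of a class sum from the flattened walks `Walk` to the tuples of [6]: the `ℤ^d` kernel `latticeCw`
vanishes off the flattened tuples. [cite: BalabanImbrieJaffe1988, (2.42) p.264] -/
theorem tsum_indicator_latticeCw_eq {M : ℕ} (A : Matrix (B4.Idx Λ N) (B4.Idx Λ N) ℝ)
    (T : Set (Walk ↥(labels M Λ))) (p q : B4.Idx Λ N) :
    ∑' ω, T.indicator (fun ω => latticeCw M Λ N A ω p q) ω
      = ∑' cc : LTup M Λ, (flatten ⁻¹' T).indicator (fun cc => term M A cc p q) cc := by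
  classical
  have hsupp : Function.support (fun ω => T.indicator (fun ω => latticeCw M Λ N A ω p q) ω)
      ⊆ Set.range (flatten (J := ↥(labels M Λ))) := by
    intro ω hω
    by_contra hr
    apply hω
    have hz : latticeCw M Λ N A ω = 0 := by
      unfold latticeCw
      exact Function.extend_apply' _ _ _ (fun ⟨cc, hcc⟩ => hr ⟨cc, hcc⟩)
    simp [Set.indicator_apply, hz]
  rw [← flatten_injective.tsum_eq hsupp]
  refine tsum_congr fun cc => ?_
  simp only [Set.indicator_apply, Set.mem_preimage, latticeCw_flatten' M A cc]

/-! ## §5 (2.47)/(2.43): the non-primed walks are long -/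

/-- the label-to-site distance, in label units: `ldist l x = M^{−1}·|Ml − x|_∞` (so `x ∈ □_l ⇒ ldist l x ≤ 1`).
[cite: BalabanImbrieJaffe1988, (2.43) p.264] -/
noncomputable def ldist (M : ℕ) (l : ↥(labels (d := d) M Λ)) (x : B4.Idx Λ N) : ℝ :=
  dist ((M : ℤ) • (l.1 : Fin d → ℤ)) (x.1 : Fin d → ℤ) / M

/-- `x ∈ □_l ⇒ ldist l x ≤ 1` (the block `□_l = {−M ≤ x_μ − Ml_μ < M}` of (5.11)). [cite: Balaban1983RegularityDecay, (5.11) p.594] -/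
theorem ldist_le_one_of_inBox {M : ℕ} (hM : 0 < M) {l : ↥(labels M Λ)} {x : B4.Idx Λ N}
    (h : InBox M l.1 (x.1 : Fin d → ℤ)) : ldist M l x ≤ 1 := by
  unfold ldist
  have hMr : (0 : ℝ) < M := by exact_mod_cast hM
  rw [div_le_one hMr]
  refine (dist_pi_le_iff hMr.le).mpr fun μ => ?_
  rw [Int.dist_eq]
  have h1 := h μ
  simp only [Pi.smul_apply, smul_eq_mul, Int.cast_mul, Int.cast_natCast]
  rw [abs_le]
  obtain ⟨ha, hb⟩ := h1
  have ha' : (-(M : ℝ)) ≤ ((x.1 : Fin d → ℤ) μ : ℝ) - (M : ℝ) * ((l.1 : Fin d → ℤ) μ : ℝ) := by exact_mod_cast ha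
  have hb' : ((x.1 : Fin d → ℤ) μ : ℝ) - (M : ℝ) * ((l.1 : Fin d → ℤ) μ : ℝ) < M := by exact_mod_cast hb
  constructor <;> linarith

/-- scaling: `|Ml − Ml′|_∞ ≤ M|l − l′|_∞`. [cite: Balaban1983RegularityDecay, (5.11) p.594] -/
theorem dist_smul_le {M : ℕ} (l l' : Fin d → ℤ) :
    dist ((M : ℤ) • l) ((M : ℤ) • l') ≤ (M : ℝ) * dist l l' := by
  refine (dist_pi_le_iff (by positivity)).mpr fun μ => ?_
  rw [Int.dist_eq]
  simp only [Pi.smul_apply, smul_eq_mul, Int.cast_mul, Int.cast_natCast]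
  rw [← mul_sub, abs_mul, Nat.abs_cast]
  refine mul_le_mul_of_nonneg_left ?_ (Nat.cast_nonneg _)
  have := dist_le_pi_dist l l' μ
  rwa [Int.dist_eq] at this

/-- triangle inequality: `ldist l x ≤ |l − l′| + ldist l′ x`. [cite: BalabanImbrieJaffe1988, (2.43) p.264] -/
theorem ldist_le_dL_add {M : ℕ} (hM : 0 < M) (l l' : ↥(labels M Λ)) (x : B4.Idx Λ N) :
    ldist M l x ≤ dL l l' + ldist M l' x := by
  unfold ldist dL
  have hMr : (0 : ℝ) < M := by exact_mod_cast hM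
  have h1 := dist_triangle ((M : ℤ) • (l.1 : Fin d → ℤ)) ((M : ℤ) • (l'.1 : Fin d → ℤ)) (x.1 : Fin d → ℤ)
  have h2 := dist_smul_le (M := M) (l.1 : Fin d → ℤ) (l'.1 : Fin d → ℤ)
  have h3 : (M : ℝ) * dist (l.1 : Fin d → ℤ) (l'.1 : Fin d → ℤ) = dist (l.1 : Fin d → ℤ) (l'.1 : Fin d → ℤ) * M :=
    mul_comm _ _
  rw [div_le_iff₀ hMr, add_mul, div_mul_cancel₀ _ hMr.ne']
  linarith

/-- a contributing tuple STARTS at `x₁` and ENDS at `x₂`: `x₁ ∈ □_{ω₀}`, `x₂ ∈ □_{ω_{2n}}` (end-point locality of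
[6] (5.17)/(5.18)). [cite: Balaban1983RegularityDecay, (5.18) p.595] -/
theorem inBox_of_term_ne_zero {M : ℕ} (hM : 0 < M) (A : Matrix (B4.Idx Λ N) (B4.Idx Λ N) ℝ) (cc : LTup M Λ)
    (x₁ x₂ : B4.Idx Λ N) (h : term M A cc x₁ x₂ ≠ 0) :
    InBox M cc.2.1.1 (x₁.1 : Fin d → ℤ) ∧ InBox M ((flatten cc).last).1 (x₂.1 : Fin d → ℤ) := by
  constructor
  · exact inBox_of_hfun_ne_zero hM fun hz => h (walkTerm_apply_eq_zero_left A cc x₁ x₂ hz)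
  · rw [← pt_len, pt_len_eq_lastPt]
    exact inBox_of_hfun_ne_zero hM fun hz => h (walkTerm_apply_eq_zero_right A cc x₁ x₂ hz)

/-- **NON-PRIMED WALKS ARE LONG**: a contributing tuple some visited label of which is farther than `ρ` from `x₁` or
from `x₂` (not in the primed sum `Σ′` of (2.43)) has `plen ≥ ρ − 1`. [cite: BalabanImbrieJaffe1988, (2.43) p.264] -/
theorem plen_ge_of_not_near {M : ℕ} (hM : 0 < M) (A : Matrix (B4.Idx Λ N) (B4.Idx Λ N) ℝ) (ρ : ℝ)
    (cc : LTup M Λ) (x₁ x₂ : B4.Idx Λ N) (hval : term M A cc x₁ x₂ ≠ 0)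
    (hfar : ¬ Near (ldist (N := N) M) ρ (flatten cc) x₁ x₂) : ρ - 1 ≤ plen cc := by
  have hne : term M A cc ≠ 0 := fun h => hval (by rw [h]; rfl)
  have hc : IsChain cc := isChain_of_term_ne_zero hM A cc hne
  obtain ⟨h1, h2⟩ := inBox_of_term_ne_zero hM A cc x₁ x₂ hval
  have hs : ldist M cc.2.1 x₁ ≤ 1 := ldist_le_one_of_inBox hM h1
  have he : ldist M (flatten cc).last x₂ ≤ 1 := ldist_le_one_of_inBox hM h2
  have hfar' : ∃ l ∈ (flatten cc).pts, ¬ (ldist (N := N) M l x₁ ≤ ρ ∧ ldist (N := N) M l x₂ ≤ ρ) := by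
    by_contra hcon
    exact hfar fun l hl => by
      by_contra h'
      exact hcon ⟨l, hl, h'⟩
  obtain ⟨l, hl, hlρ⟩ := hfar'
  rw [not_and_or, not_le, not_le] at hlρ
  rcases hlρ with hx | hx
  · -- `l` is far from `x₁`
    have ht := ldist_le_dL_add hM l cc.2.1 x₁
    have hd := dL_start_le_plen cc hc hl
    rw [dL_comm] at hd
    linarith
  · -- `l` is far from `x₂`
    have ht := ldist_le_dL_add hM l (flatten cc).last x₂
    have hd := dL_last_le_plen cc hc hl
    linarith

/-- the local part minus the whole is (minus) the sum over the NON-primed walks: `C_{Λ,loc}(x₁,x₂) − A_Λ^{−1}(x₁,x₂) =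
−Σ_{ω ∉ Σ′} C_ω(x₁,x₂)` ((2.42) + (2.43)). [cite: BalabanImbrieJaffe1988, (2.43) p.264] -/
theorem cLoc_sub_inv_eq (hγ : 0 < γ₀) (hc : 0 ≤ c₀) (hδ : 0 < δ₀) {A : Matrix (B4.Idx Λ N) (B4.Idx Λ N) ℝ}
    (hA : B4.Hyp56 Λ A γ₀ c₀ δ₀) {M : ℕ} (hM : 5 ≤ M) (hMR : kR d N γ₀ c₀ δ₀ < M)
    (hMθ : thetaConst d N γ₀ c₀ δ₀ < M) (ρ : ℝ) (x₁ x₂ : B4.Idx Λ N) :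
    cLoc (ldist (N := N) M) ρ (fun ω y₁ y₂ => latticeCw M Λ N A ω y₁ y₂) x₁ x₂ - A⁻¹ x₁ x₂
      = -∑' cc : LTup M Λ,
          (flatten ⁻¹' {ω | ¬ Near (ldist (N := N) M) ρ ω x₁ x₂}).indicator (fun cc => term M A cc x₁ x₂) cc := by
  have h242 := eq242_lattice hγ hc hδ hA hM hMR hMθ x₁ x₂
  have hs : Summable fun ω : Walk ↥(labels M Λ) => latticeCw M Λ N A ω x₁ x₂ := h242.summable
  set T : Set (Walk ↥(labels M Λ)) := {ω | Near (ldist (N := N) M) ρ ω x₁ x₂} with hT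
  have hcompl : {ω : Walk ↥(labels M Λ) | ¬ Near (ldist (N := N) M) ρ ω x₁ x₂} = Tᶜ := by
    ext ω; simp [hT]
  rw [hcompl, ← tsum_indicator_latticeCw_eq A Tᶜ x₁ x₂]
  have hind : ∀ ω, Tᶜ.indicator (fun ω => latticeCw M Λ N A ω x₁ x₂) ω
      = latticeCw M Λ N A ω x₁ x₂ - T.indicator (fun ω => latticeCw M Λ N A ω x₁ x₂) ω := fun ω => by
    rw [Set.indicator_compl]; rfl
  simp_rw [hind]
  rw [Summable.tsum_sub hs (hs.indicator T), h242.tsum_eq]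
  simp only [cLoc, ← hT]
  ring

/-- `|∑' f| ≤ ∑' |f|` for absolutely summable real families. [folklore] -/
private theorem abs_tsum_le_tsum_abs {ι : Type*} {F : ι → ℝ} (hF : Summable fun i => |F i|) :
    |∑' i, F i| ≤ ∑' i, |F i| := by
  have h := norm_tsum_le_tsum_norm (f := F) (by simpa [Real.norm_eq_abs] using hF)
  simpa [Real.norm_eq_abs] using h

/-- **(2.47) FOR THE `ℤ^d` OPERATORS OF [6]** — *"|C^{(k)}_{Λ,loc}(u; x₁, x₂) − C^{(k)}_Λ(u; x₁, x₂)| ≦ e^{−cr(e_k)}.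
(2.47)"*: for every finite `Λ ⊂ ℤ^d`, every `A` on `L²(Λ; ℝ^N)` with (5.6), cubes `M ≥ 5`, `M > K_R`, `M > Θ₁`,
`θ_W(M) < 1`, every radius `ρ` (print: `¼r(e_k)`, in label units) and all sites `x₁, x₂`:
`|C_{Λ,loc}(x₁,x₂) − A_Λ^{−1}(x₁,x₂)| ≤ 2^dγ₀^{−1}(1 − θ_W(M))^{−1}·e^{−(δ₀/8)(ρ − 1)}` — the primed sum's complement
is carried by walks of label path length `≥ ρ − 1`. [cite: BalabanImbrieJaffe1988, (2.47) p.265] -/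
theorem abs_cLoc_sub_inv_le (hγ : 0 < γ₀) (hc : 0 ≤ c₀) (hδ : 0 < δ₀) {A : Matrix (B4.Idx Λ N) (B4.Idx Λ N) ℝ}
    (hA : B4.Hyp56 Λ A γ₀ c₀ δ₀) {M : ℕ} (hM : 5 ≤ M) (hMR : kR d N γ₀ c₀ δ₀ < M)
    (hMθ : thetaConst d N γ₀ c₀ δ₀ < M) (hθW : thetaW d N γ₀ c₀ δ₀ M < 1) (ρ : ℝ) (x₁ x₂ : B4.Idx Λ N) :
    |cLoc (ldist (N := N) M) ρ (fun ω y₁ y₂ => latticeCw M Λ N A ω y₁ y₂) x₁ x₂ - A⁻¹ x₁ x₂|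
      ≤ 2 ^ d * γ₀⁻¹ * (1 - thetaW d N γ₀ c₀ δ₀ M)⁻¹ * Real.exp (-(δ₀ / 8 * (ρ - 1))) := by
  have hM0 : 0 < M := by omega
  rw [cLoc_sub_inv_eq hγ hc hδ hA hM hMR hMθ ρ x₁ x₂, abs_neg]
  have hSL : ∀ cc ∈ flatten ⁻¹' {ω | ¬ Near (ldist (N := N) M) ρ ω x₁ x₂}, term M A cc x₁ x₂ ≠ 0 →
      ρ - 1 ≤ plen cc :=
    fun cc hcc hne => plen_ge_of_not_near hM0 A ρ cc x₁ x₂ hne hcc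
  exact (abs_tsum_le_tsum_abs (summable_abs_indicator_term hγ hc hδ hA hM hMR hMθ _ x₁ x₂)).trans
    (abs_tsum_class_le hγ hc hδ hA hM hMR hMθ hθW _ (ρ - 1) x₁ x₂ hSL)

/-- the site distance in LABEL units, `M^{−1}|x₁ − x₂|_∞` (the `|x₁ − x₂|` of (2.47), up to the factor `M`).
[cite: BalabanImbrieJaffe1988, (2.47) p.265] -/
noncomputable def sdist (M : ℕ) (x₁ x₂ : B4.Idx Λ N) : ℝ := dist (x₁.1 : Fin d → ℤ) (x₂.1 : Fin d → ℤ) / M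

/-- the site distance is dominated through any label: `sdist x₁ x₂ ≤ ldist l x₁ + ldist l x₂` (the `htri` of
`BIJ88RandomWalk242.cLoc_eq_zero_of_far`). [cite: BalabanImbrieJaffe1988, (2.43) p.264] -/
theorem sdist_le_ldist_add {M : ℕ} (l : ↥(labels M Λ)) (x₁ x₂ : B4.Idx Λ N) :
    sdist (N := N) M x₁ x₂ ≤ ldist M l x₁ + ldist M l x₂ := by
  have h := dist_triangle (x₁.1 : Fin d → ℤ) ((M : ℤ) • (l.1 : Fin d → ℤ)) (x₂.1 : Fin d → ℤ)
  rw [dist_comm (x₁.1 : Fin d → ℤ) ((M : ℤ) • (l.1 : Fin d → ℤ))] at h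
  unfold sdist ldist
  rw [← add_div]
  exact div_le_div_of_nonneg_right h (Nat.cast_nonneg _)

/-- a contributing walk joins the blocks of its two arguments (`x₁ ∈ □_{ω₀}`, `x₂ ∈ □_{ω_{2n}}`), so
`sdist x₁ x₂ ≤ plen + 2`. [cite: BalabanImbrieJaffe1988, (2.47) p.265] -/
theorem sdist_le_plen_add_two {M : ℕ} (hM : 0 < M) (A : Matrix (B4.Idx Λ N) (B4.Idx Λ N) ℝ) (cc : LTup M Λ)
    (x₁ x₂ : B4.Idx Λ N) (hval : term M A cc x₁ x₂ ≠ 0) : sdist (N := N) M x₁ x₂ ≤ plen cc + 2 := by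
  have hne : term M A cc ≠ 0 := fun h => hval (by rw [h]; rfl)
  have hc : IsChain cc := isChain_of_term_ne_zero hM A cc hne
  obtain ⟨h1, h2⟩ := inBox_of_term_ne_zero hM A cc x₁ x₂ hval
  have e1 := ldist_le_one_of_inBox (N := N) hM h1
  have e2 := ldist_le_one_of_inBox (N := N) hM h2
  have e3 : dL cc.2.1 (flatten cc).last ≤ plen cc := dL_start_le_plen cc hc (flatten cc).last_mem_pts
  have t1 := sdist_le_ldist_add (N := N) cc.2.1 x₁ x₂
  have t2 := ldist_le_dL_add hM cc.2.1 (flatten cc).last x₂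
  linarith

/-- **(2.47) AS THE TYPED ROW `BIJ88Sect2Statements.Close` FOR THE `ℤ^d` OPERATORS OF [6]** —
*"|C^{(k)}_{Λ,loc}(u; x₁, x₂) − C^{(k)}_Λ(u; x₁, x₂)| ≦ e^{−cr(e_k)}e^{−c|x₁−x₂|}. (2.47)"*: with the site distance
`sdist` in label units, `Close sdist C_{Λ,loc} A_Λ^{−1} δ c` holds (the MATRIX inverse `A_Λ^{−1}` as a kernel) with
`c = δ₀/16` and
`δ = 2^dγ₀^{−1}(1 − θ_W(M))^{−1}e^{−(δ₀/16)(ρ − 3)}` — a contributing non-primed walk has path length both `≥ ρ − 1`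
and `≥ sdist(x₁,x₂) − 2`, hence `≥` their mean. [cite: BalabanImbrieJaffe1988, (2.47) p.265] -/
theorem close247_lattice (hγ : 0 < γ₀) (hc : 0 ≤ c₀) (hδ : 0 < δ₀) {A : Matrix (B4.Idx Λ N) (B4.Idx Λ N) ℝ}
    (hA : B4.Hyp56 Λ A γ₀ c₀ δ₀) {M : ℕ} (hM : 5 ≤ M) (hMR : kR d N γ₀ c₀ δ₀ < M)
    (hMθ : thetaConst d N γ₀ c₀ δ₀ < M) (hθW : thetaW d N γ₀ c₀ δ₀ M < 1) (ρ : ℝ) :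
    BIJ88Sect2Statements.Close (sdist (N := N) M)
      (cLoc (ldist (N := N) M) ρ (fun ω y₁ y₂ => latticeCw M Λ N A ω y₁ y₂))
      (fun x₁ x₂ => (A⁻¹ : Matrix (B4.Idx Λ N) (B4.Idx Λ N) ℝ) x₁ x₂)
      (2 ^ d * γ₀⁻¹ * (1 - thetaW d N γ₀ c₀ δ₀ M)⁻¹ * Real.exp (-(δ₀ / 16 * (ρ - 3)))) (δ₀ / 16) := by
  intro x₁ x₂
  have hM0 : 0 < M := by omega
  show |cLoc (ldist (N := N) M) ρ (fun ω y₁ y₂ => latticeCw M Λ N A ω y₁ y₂) x₁ x₂ - A⁻¹ x₁ x₂| ≤ _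
  rw [cLoc_sub_inv_eq hγ hc hδ hA hM hMR hMθ ρ x₁ x₂, abs_neg]
  set L : ℝ := ((ρ - 1) + (sdist (N := N) M x₁ x₂ - 2)) / 2 with hL
  have hSL : ∀ cc ∈ flatten ⁻¹' {ω | ¬ Near (ldist (N := N) M) ρ ω x₁ x₂}, term M A cc x₁ x₂ ≠ 0 →
      L ≤ plen cc := by
    intro cc hcc hne
    have h1 := plen_ge_of_not_near hM0 A ρ cc x₁ x₂ hne hcc
    have h2 := sdist_le_plen_add_two hM0 A cc x₁ x₂ hne
    rw [hL]; linarith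
  refine ((abs_tsum_le_tsum_abs (summable_abs_indicator_term hγ hc hδ hA hM hMR hMθ _ x₁ x₂)).trans
    (abs_tsum_class_le hγ hc hδ hA hM hMR hMθ hθW _ L x₁ x₂ hSL)).trans (le_of_eq ?_)
  rw [hL, mul_assoc (2 ^ d * γ₀⁻¹ * (1 - thetaW d N γ₀ c₀ δ₀ M)⁻¹), ← Real.exp_add]
  congr 2
  ring

/-! ## §6 (2.46): walks filling `X` are long -/

/-- the `r(e_k)`-cube label of a cube label: cubes of `s` labels a side (`s` = `r(e_k)/M` label units; coordinatewise
integer division). [cite: BalabanImbrieJaffe1988, (2.44) p.264] -/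
def cubeLab (s : ℕ) (l : Fin d → ℤ) : Fin d → ℤ := fun μ => l μ / (s : ℤ)

/-- the (finite) type of `r(e_k)`-cubes meeting the labels of `Λ`. [cite: BalabanImbrieJaffe1988, (2.44) p.264] -/
abbrev Cubes (M s : ℕ) (Λ : Finset (Fin d → ℤ)) := ↥((labels M Λ).image (cubeLab s))

/-- the cube of a label. [cite: BalabanImbrieJaffe1988, (2.44) p.264] -/
def cubeOf (M s : ℕ) (l : ↥(labels (d := d) M Λ)) : Cubes M s Λ :=
  ⟨cubeLab s l.1, Finset.mem_image_of_mem _ l.2⟩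

/-- touching / boundary-layer adjacency of cubes: sup-distance of cube labels `≤ 1` (reflexive, symmetric, at most
`3^d` cubes touch a given one). [cite: BalabanImbrieJaffe1988, (2.44) p.264] -/
def touch {M s : ℕ} (c c' : Cubes (d := d) M s Λ) : Prop := Adj c.1 c'.1

/-- touching is reflexive. [cite: BalabanImbrieJaffe1988, (2.44) p.264] -/
theorem touch_refl {M s : ℕ} (c : Cubes (d := d) M s Λ) : touch c c := fun μ => by simp

/-- touching is symmetric. [cite: BalabanImbrieJaffe1988, (2.44) p.264] -/
theorem touch_symm {M s : ℕ} {c c' : Cubes (d := d) M s Λ} (h : touch c c') : touch c' c :=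
  fun μ => by rw [abs_sub_comm]; exact h μ

/-- at most `3^d` cubes of any family touch a given cube. [cite: BalabanImbrieJaffe1988, (2.46) p.264] -/
theorem card_filter_touch_le {M s : ℕ} [DecidableRel (touch (d := d) (Λ := Λ) (M := M) (s := s))]
    (c : Cubes (d := d) M s Λ) (Y : Finset (Cubes M s Λ)) : (Y.filter fun c' => touch c c').card ≤ 3 ^ d := by
  classical
  calc (Y.filter fun c' => touch c c').card
      ≤ ((Y.image Subtype.val).filter fun j => Adj c.1 j).card := by
        refine Finset.card_le_card_of_injOn Subtype.val (fun c' hc' => ?_) ?_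
        · rw [Finset.mem_coe, Finset.mem_filter] at hc' ⊢
          exact ⟨Finset.mem_image_of_mem _ hc'.1, hc'.2⟩
        · exact Set.injOn_of_injective Subtype.val_injective
    _ ≤ 3 ^ d := card_filter_adj_le _ _

/-- labels in non-touching cubes are more than `s` apart: `|l − l′|_∞ ≥ s + 1`. [cite: BalabanImbrieJaffe1988, (2.46) p.264] -/
theorem dL_ge_of_not_touch {M s : ℕ} (hs : 0 < s) {l l' : ↥(labels (d := d) M Λ)}
    (h : ¬ touch (cubeOf M s l) (cubeOf M s l')) : (s : ℝ) + 1 ≤ dL l l' := by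
  unfold touch Adj at h
  push Not at h
  obtain ⟨μ, hμ⟩ := h
  simp only [cubeOf, cubeLab] at hμ
  set a : ℤ := (l.1 : Fin d → ℤ) μ with ha
  set b : ℤ := (l'.1 : Fin d → ℤ) μ with hb
  have hs0 : (0 : ℤ) < s := by exact_mod_cast hs
  have hsne : (s : ℤ) ≠ 0 := hs0.ne'
  -- `a/s − b/s ≥ 2` ⇒ `a − b ≥ s + 1` (Euclidean division)
  have key : ∀ a b : ℤ, 2 ≤ a / s - b / s → (s : ℤ) + 1 ≤ a - b := by
    intro a b h2
    have ea := Int.emod_add_mul_ediv a s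
    have eb := Int.emod_add_mul_ediv b s
    have ra0 := Int.emod_nonneg a hsne
    have rbs := Int.emod_lt_of_pos b hs0
    have hm : (s : ℤ) * 2 ≤ s * (a / s) - s * (b / s) := by
      rw [← mul_sub]; exact mul_le_mul_of_nonneg_left h2 hs0.le
    linarith
  have hab : (s : ℤ) + 1 ≤ |a - b| := by
    rcases le_or_gt 0 (a / s - b / s) with hq | hq
    · rw [abs_of_nonneg hq] at hμ
      exact (key a b (by omega)).trans (le_abs_self _)
    · rw [abs_of_neg hq] at hμ
      exact (key b a (by omega)).trans ((le_abs_self _).trans_eq (abs_sub_comm b a))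
  have h1 : dist a b ≤ dL l l' := by
    unfold dL; rw [ha, hb]; exact dist_le_pi_dist _ _ μ
  rw [Int.dist_eq] at h1
  have h3 : ((s : ℝ) + 1) ≤ |((a : ℝ) - b)| := by exact_mod_cast hab
  exact h3.trans h1

/-- `e^{δ₀/8}`-inflated prefactor `K₀ = 2^dγ₀^{−1}(1 − θ_W(M))^{−1}e^{δ₀/8}` of the lattice (2.46)/(2.47).
[cite: BalabanImbrieJaffe1988, (2.46) p.264] -/
noncomputable def K0 (d N : ℕ) (γ₀ c₀ δ₀ : ℝ) (M : ℕ) : ℝ :=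
  2 ^ d * γ₀⁻¹ * (1 - thetaW d N γ₀ c₀ δ₀ M)⁻¹ * Real.exp (δ₀ / 8)

/-- **WALKS FILLING `X` ARE LONG**: a contributing tuple of the class `X` (not primed for `ρ = s/4`, cube region
`= X`) has `plen ≥ (s/(8·9^d))|X| − 1` (a pairwise-far subfamily of `≥ |X|/9^d` of the met cubes, consecutive far
cubes `> s` apart in path length; and `plen ≥ ρ − 1` from being non-primed). [cite: BalabanImbrieJaffe1988, (2.46) p.264] -/
theorem plen_ge_of_region {M s : ℕ} (hM : 0 < M) (hs : 0 < s) (A : Matrix (B4.Idx Λ N) (B4.Idx Λ N) ℝ)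
    (cc : LTup M Λ) (x₁ x₂ : B4.Idx Λ N) (hval : term M A cc x₁ x₂ ≠ 0)
    (hfar : ¬ Near (ldist (N := N) M) ((s : ℝ) / 4) (flatten cc) x₁ x₂) (X : Finset (Cubes M s Λ))
    (hX : region (cubeOf M s) touch (flatten cc) = X) :
    (s : ℝ) / (8 * 9 ^ d) * (X.card : ℝ) - 1 ≤ plen cc := by
  classical
  have hne : term M A cc ≠ 0 := fun h => hval (by rw [h]; rfl)
  have hch : IsChain cc := isChain_of_term_ne_zero hM A cc hne
  have hρ : (s : ℝ) / 4 - 1 ≤ plen cc := plen_ge_of_not_near hM A _ cc x₁ x₂ hval hfar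
  -- the cubes met, the far subfamily
  set Y : Finset (Cubes M s Λ) := cubesMet (cubeOf M s) (flatten cc) with hY
  have hXY : X.card ≤ 3 ^ d * Y.card := by
    rw [← hX]
    refine card_le_of_covered (touch (M := M) (s := s)) (K' := 3 ^ d)
      (fun c => card_filter_touch_le c _) Y _ fun c' hc' => ?_
    rcases mem_closure.mp hc' with h | ⟨c, hc, hcc⟩
    · exact ⟨c', h, touch_refl c'⟩
    · exact ⟨c, hc, hcc⟩
  obtain ⟨F, hFY, hfar', hYF⟩ := exists_far_subfamily (touch (M := M) (s := s)) touch_refl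
    (fun c c' h => touch_symm h) (fun c Z => card_filter_touch_le c Z) Y
  -- `F` is non-empty: the start's cube is met
  have hYne : Y.Nonempty := ⟨cubeOf M s (flatten cc).start, Finset.mem_image_of_mem _ (flatten cc).start_mem_pts⟩
  have hFpos : 0 < F.card := by
    by_contra h0
    push Not at h0
    have : Y.card = 0 := by have := hYF; interval_cases F.card; omega
    exact hYne.ne_empty (Finset.card_eq_zero.mp this)
  obtain ⟨m, hm⟩ : ∃ m, F.card = m + 1 := ⟨F.card - 1, by omega⟩
  -- far cubes cost path length `s`
  have hsep : ∀ t₁ t₂ : ℕ, t₁ ≤ t₂ → t₂ ≤ 2 * cc.1 →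
      ¬ touch (cubeOf M s (pt cc t₁)) (cubeOf M s (pt cc t₂)) → (s : ℝ) ≤ pathCost cc t₂ - pathCost cc t₁ := by
    intro t₁ t₂ h12 h2 hnt
    have h1 := dL_ge_of_not_touch hs hnt
    have h2' := dL_pt_le_pathCost cc h12 h2
    linarith
  have hvis : ∀ Q ∈ F, ∃ t, t ≤ 2 * cc.1 ∧ t ≤ 2 * cc.1 ∧ cubeOf M s (pt cc t) = Q := by
    intro Q hQ
    obtain ⟨l, hl, rfl⟩ := Finset.mem_image.mp (hFY hQ)
    obtain ⟨t, ht, rfl⟩ := (mem_pts_flatten_iff cc l).mp hl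
    exact ⟨t, ht, ht, rfl⟩
  have hfam := far_family_le_cost (j := cc.2.1) (ys := (flatten cc).steps) (cubeOf M s) touch (s : ℝ)
    (pathCost cc) (pathCost_mono cc) hsep m F hm hfar' (2 * cc.1) hvis
  rw [pathCost_zero, sub_zero] at hfam
  have hplen := pathCost_le_plen cc hch
  -- arithmetic: plen ≥ max(s/4 − 1, s·m) and |X| ≤ 9^d (m+1)
  have hX9 : (X.card : ℝ) ≤ 9 ^ d * ((m : ℝ) + 1) := by
    have h1 : (X.card : ℝ) ≤ 3 ^ d * (Y.card : ℝ) := by exact_mod_cast hXY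
    have h2 : (Y.card : ℝ) ≤ 3 ^ d * (F.card : ℝ) := by exact_mod_cast hYF
    rw [hm] at h2; push_cast at h2
    have : (9 : ℝ) ^ d = 3 ^ d * 3 ^ d := by rw [← mul_pow]; norm_num
    rw [this]; nlinarith [pow_nonneg (by norm_num : (0:ℝ) ≤ 3) d]
  have hs0 : (0 : ℝ) ≤ s := Nat.cast_nonneg _
  have h9 : (0 : ℝ) < 9 ^ d := by positivity
  have hms : (m : ℝ) * s ≤ plen cc := hfam.trans hplen
  set q : ℝ := (s : ℝ) / (8 * 9 ^ d) with hq
  have hq0 : 0 ≤ q := by positivity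
  have hq9 : q * 9 ^ d = s / 8 := by rw [hq]; field_simp
  have hqX : q * (X.card : ℝ) ≤ s / 8 * ((m : ℝ) + 1) :=
    calc q * (X.card : ℝ) ≤ q * (9 ^ d * ((m : ℝ) + 1)) := mul_le_mul_of_nonneg_left hX9 hq0
      _ = q * 9 ^ d * ((m : ℝ) + 1) := by ring
      _ = s / 8 * ((m : ℝ) + 1) := by rw [hq9]
  rcases Nat.eq_zero_or_pos m with rfl | hmpos
  · -- one far cube: `|X| ≤ 9^d`, use the non-primed bound
    simp only [Nat.cast_zero, zero_add, mul_one] at hqX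
    linarith
  · have hm1 : (1 : ℝ) ≤ m := by exact_mod_cast hmpos
    have h2 : (s : ℝ) / 8 * ((m : ℝ) + 1) ≤ s / 8 * (2 * m) :=
      mul_le_mul_of_nonneg_left (by linarith) (by positivity)
    have h3 : (0 : ℝ) ≤ m * s := by positivity
    linarith

/-- **(2.46) FOR THE `ℤ^d` OPERATORS OF [6]** — *"|C^{(k)}_{Λ,X}(u; x₁, x₂)| ≦ e^{−cr(e_k)|X|}. (2.46)"*: with the
`r(e_k)`-cubes of side `s` labels (`ρ = ¼r(e_k) = s/4`), for every finite `Λ ⊂ ℤ^d`, `A` with (5.6), `M ≥ 5`,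
`M > K_R`, `M > Θ₁`, `θ_W(M) < 1`, every cube region `X` and all sites:
`|C_{Λ,X}(x₁,x₂)| ≤ K₀·e^{−(δ₀s/(64·9^d))·|X|}`, `K₀ = 2^dγ₀^{−1}(1−θ_W)^{−1}e^{δ₀/8}`, `|X|` = number of cubes.
[cite: BalabanImbrieJaffe1988, (2.46) p.264] -/
theorem abs_cX_lattice_le (hγ : 0 < γ₀) (hc : 0 ≤ c₀) (hδ : 0 < δ₀) {A : Matrix (B4.Idx Λ N) (B4.Idx Λ N) ℝ}
    (hA : B4.Hyp56 Λ A γ₀ c₀ δ₀) {M : ℕ} (hM : 5 ≤ M) (hMR : kR d N γ₀ c₀ δ₀ < M)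
    (hMθ : thetaConst d N γ₀ c₀ δ₀ < M) (hθW : thetaW d N γ₀ c₀ δ₀ M < 1) {s : ℕ} (hs : 0 < s)
    (X : Finset (Cubes M s Λ)) (x₁ x₂ : B4.Idx Λ N) :
    |cX (ldist (N := N) M) ((s : ℝ) / 4) (cubeOf M s) touch (fun ω y₁ y₂ => latticeCw M Λ N A ω y₁ y₂) X x₁ x₂|
      ≤ K0 d N γ₀ c₀ δ₀ M * Real.exp (-(δ₀ * s / (64 * 9 ^ d) * X.card)) := by
  classical
  have hM0 : 0 < M := by omega
  set T : Set (Walk ↥(labels M Λ)) :=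
    {ω | ¬ Near (ldist (N := N) M) ((s : ℝ) / 4) ω x₁ x₂ ∧ region (cubeOf M s) touch ω = X} with hT
  have hcX : cX (ldist (N := N) M) ((s : ℝ) / 4) (cubeOf M s) touch (fun ω y₁ y₂ => latticeCw M Λ N A ω y₁ y₂) X x₁ x₂
      = ∑' cc : LTup M Λ, (flatten ⁻¹' T).indicator (fun cc => term M A cc x₁ x₂) cc := by
    rw [← tsum_indicator_latticeCw_eq A T x₁ x₂]; rfl
  set L : ℝ := (s : ℝ) / (8 * 9 ^ d) * (X.card : ℝ) - 1 with hL
  have hSL : ∀ cc ∈ flatten ⁻¹' T, term M A cc x₁ x₂ ≠ 0 → L ≤ plen cc := by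
    intro cc hcc hne
    obtain ⟨hfar, hreg⟩ := hcc
    exact plen_ge_of_region hM0 hs A cc x₁ x₂ hne hfar X hreg
  have h1 := abs_tsum_le_tsum_abs (summable_abs_indicator_term hγ hc hδ hA hM hMR hMθ (flatten ⁻¹' T) x₁ x₂)
  have h2 := abs_tsum_class_le hγ hc hδ hA hM hMR hMθ hθW (flatten ⁻¹' T) L x₁ x₂ hSL
  rw [hcX]
  refine h1.trans (h2.trans (le_of_eq ?_))
  rw [K0, hL, mul_assoc (2 ^ d * γ₀⁻¹ * (1 - thetaW d N γ₀ c₀ δ₀ M)⁻¹), ← Real.exp_add]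
  congr 2
  ring

/-- END-POINT LOCALITY of the `ℤ^d` walk terms (hypothesis `hsupp` of `BIJ88RandomWalk242.cX_support` /
`ineq246_of_bound`, DISCHARGED): `C_ω(x₁,x₂) ≠ 0 ⇒ x₁ ∈ □_{ω₀}` and `x₂ ∈ □_{ω_{2n}}`. [cite: BalabanImbrieJaffe1988, (2.46) p.264] -/
theorem latticeCw_support {M : ℕ} (hM : 0 < M) (A : Matrix (B4.Idx Λ N) (B4.Idx Λ N) ℝ) :
    ∀ (ω : Walk ↥(labels M Λ)) (x₁ x₂ : B4.Idx Λ N), latticeCw M Λ N A ω x₁ x₂ ≠ 0 →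
      InBox M ω.start.1 (x₁.1 : Fin d → ℤ) ∧ InBox M ω.last.1 (x₂.1 : Fin d → ℤ) := by
  intro ω x₁ x₂ hne
  by_cases hr : ∃ cc : LTup M Λ, flatten cc = ω
  · obtain ⟨cc, rfl⟩ := hr
    rw [latticeCw_flatten'] at hne
    exact inBox_of_term_ne_zero hM A cc x₁ x₂ hne
  · exfalso; apply hne
    have hz : latticeCw M Λ N A ω = 0 := by
      unfold latticeCw
      exact Function.extend_apply' _ _ _ hr
    rw [hz]; rfl

/-- the cube region of a walk is never empty (the start's cube belongs to it). [cite: BalabanImbrieJaffe1988, (2.44) p.264] -/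
theorem region_nonempty {M s : ℕ} (ω : Walk ↥(labels (d := d) M Λ)) :
    (region (cubeOf M s) touch ω).Nonempty :=
  ⟨cubeOf M s ω.start, subset_closure _ _ (Finset.mem_image_of_mem _ ω.start_mem_pts)⟩

/-- **THE TYPED ROW (2.46) FOR THE LATTICE DATA, IN THE PRINTED FORM `e^{−c·r·|X|}`**: with `r = s` (the cube side
in label units, `= r(e_k)/M`) and `c = δ₀/(128·9^d)`, `BIJ88Sect2Statements.Ineq246 (|·|) (memX □ cubeOf touch)
(C_{Λ,X}) c r` holds — support clause from `latticeCw_support`, bound from `abs_cX_lattice_le` — as soon as `r` is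
large enough to absorb the prefactor, `K₀ ≤ e^{c·r}` (p. 260: `r(e_k) = |log e_k⁻¹|^r → ∞`).
[cite: BalabanImbrieJaffe1988, (2.46) p.264] -/
theorem ineq246_lattice (hγ : 0 < γ₀) (hc : 0 ≤ c₀) (hδ : 0 < δ₀) {A : Matrix (B4.Idx Λ N) (B4.Idx Λ N) ℝ}
    (hA : B4.Hyp56 Λ A γ₀ c₀ δ₀) {M : ℕ} (hM : 5 ≤ M) (hMR : kR d N γ₀ c₀ δ₀ < M)
    (hMθ : thetaConst d N γ₀ c₀ δ₀ < M) (hθW : thetaW d N γ₀ c₀ δ₀ M < 1) {s : ℕ} (hs : 0 < s)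
    (hlarge : K0 d N γ₀ c₀ δ₀ M ≤ Real.exp (δ₀ / (128 * 9 ^ d) * s)) :
    BIJ88Sect2Statements.Ineq246 (fun X : Finset (Cubes M s Λ) => X.card)
      (memX (fun (x : B4.Idx Λ N) (l : ↥(labels M Λ)) => InBox M l.1 (x.1 : Fin d → ℤ)) (cubeOf M s) touch)
      (cX (ldist (N := N) M) ((s : ℝ) / 4) (cubeOf M s) touch (fun ω y₁ y₂ => latticeCw M Λ N A ω y₁ y₂))
      (δ₀ / (128 * 9 ^ d)) s := by
  classical
  have hM0 : 0 < M := by omega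
  refine ineq246_of_bound (ldist (N := N) M) ((s : ℝ) / 4) (cubeOf M s) touch
    (fun (x : B4.Idx Λ N) (l : ↥(labels M Λ)) => InBox M l.1 (x.1 : Fin d → ℤ)) (latticeCw_support hM0 A)
    (δ₀ / (128 * 9 ^ d)) s fun X x₁ x₂ => ?_
  have hb := abs_cX_lattice_le hγ hc hδ hA hM hMR hMθ hθW hs X x₁ x₂
  rcases Nat.eq_zero_or_pos X.card with h0 | hpos
  · -- `X = ∅` carries no walk: every walk's region is non-empty
    have hX : X = ∅ := Finset.card_eq_zero.mp h0
    have hz : cX (ldist (N := N) M) ((s : ℝ) / 4) (cubeOf M s) touch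
        (fun ω y₁ y₂ => latticeCw M Λ N A ω y₁ y₂) X x₁ x₂ = 0 := by
      unfold cX
      rw [← tsum_zero (β := Walk ↥(labels M Λ))]
      refine tsum_congr fun ω => Set.indicator_apply_eq_zero.mpr fun hω => ?_
      exfalso
      have h := region_nonempty (s := s) ω
      rw [hω.2, hX] at h
      exact Finset.not_nonempty_empty h
    rw [hz, abs_zero]; positivity
  · refine hb.trans ?_
    have hX1 : (1 : ℝ) ≤ X.card := by exact_mod_cast hpos
    have hK0 : 0 ≤ K0 d N γ₀ c₀ δ₀ M := by
      unfold K0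
      have : 0 < 1 - thetaW d N γ₀ c₀ δ₀ M := by linarith
      positivity
    calc K0 d N γ₀ c₀ δ₀ M * Real.exp (-(δ₀ * s / (64 * 9 ^ d) * X.card))
        ≤ Real.exp (δ₀ / (128 * 9 ^ d) * s) * Real.exp (-(δ₀ * s / (64 * 9 ^ d) * X.card)) :=
          mul_le_mul_of_nonneg_right hlarge (Real.exp_pos _).le
      _ = Real.exp (δ₀ / (128 * 9 ^ d) * s - δ₀ * s / (64 * 9 ^ d) * X.card) := by
          rw [← Real.exp_add, ← sub_eq_add_neg]
      _ ≤ Real.exp (-(δ₀ / (128 * 9 ^ d)) * s * X.card) := by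
          apply Real.exp_le_exp.mpr
          have h9 : (0 : ℝ) < 9 ^ d := by positivity
          have hs0 : (0 : ℝ) < s := by exact_mod_cast hs
          have : δ₀ / (128 * 9 ^ d) * s ≤ δ₀ / (128 * 9 ^ d) * s * X.card :=
            le_mul_of_one_le_right (by positivity) hX1
          have e : δ₀ * s / (64 * 9 ^ d) * X.card = 2 * (δ₀ / (128 * 9 ^ d) * s * X.card) := by ring
          rw [e]; linarith

/-! ## §7 (2.41) and (2.43) «bounded as in (2.41)» for the `ℤ^d` operators (v1.1) -/

/-- the site distance is non-negative. [cite: BalabanImbrieJaffe1988, (2.41) p.264] -/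
theorem sdist_nonneg {M : ℕ} (x₁ x₂ : B4.Idx Λ N) : 0 ≤ sdist (N := N) M x₁ x₂ := by
  unfold sdist; positivity

/-- EVERY class of walks decays in the site distance: a contributing walk has path length `≥ sdist(x₁,x₂) − 2`, so
`Σ_{ω∈S}|C_ω(x₁,x₂)| ≤ 2^dγ₀^{−1}(1 − θ_W)^{−1}e^{−(δ₀/8)(sdist(x₁,x₂) − 2)}`. [cite: BalabanImbrieJaffe1988, (2.41) p.264] -/
theorem abs_tsum_class_le_sdist (hγ : 0 < γ₀) (hc : 0 ≤ c₀) (hδ : 0 < δ₀)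
    {A : Matrix (B4.Idx Λ N) (B4.Idx Λ N) ℝ} (hA : B4.Hyp56 Λ A γ₀ c₀ δ₀) {M : ℕ} (hM : 5 ≤ M)
    (hMR : kR d N γ₀ c₀ δ₀ < M) (hMθ : thetaConst d N γ₀ c₀ δ₀ < M) (hθW : thetaW d N γ₀ c₀ δ₀ M < 1)
    (S : Set (LTup M Λ)) (x₁ x₂ : B4.Idx Λ N) :
    ∑' cc : LTup M Λ, |S.indicator (fun cc => term M A cc x₁ x₂) cc|
      ≤ 2 ^ d * γ₀⁻¹ * (1 - thetaW d N γ₀ c₀ δ₀ M)⁻¹ * Real.exp (-(δ₀ / 8 * (sdist (N := N) M x₁ x₂ - 2))) := by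
  have hM0 : 0 < M := by omega
  exact abs_tsum_class_le hγ hc hδ hA hM hMR hMθ hθW S _ x₁ x₂ fun cc _ hne => by
    linarith [sdist_le_plen_add_two hM0 A cc x₁ x₂ hne]

/-- **(2.43) «The local covariance C^{(k)}_{Λ,loc}(u; x₁, x₂) … is bounded as in (2.41)»** FOR THE `ℤ^d`
OPERATORS OF [6]: `|C_{Λ,loc}(x₁,x₂)| ≤ 2^dγ₀^{−1}(1 − θ_W)^{−1}e^{δ₀/4}·e^{−(δ₀/8)·sdist(x₁,x₂)}` for every radius
`ρ`, `sdist` the site distance in label units. [cite: BalabanImbrieJaffe1988, (2.43) p.264] -/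
theorem abs_cLoc_lattice_le (hγ : 0 < γ₀) (hc : 0 ≤ c₀) (hδ : 0 < δ₀) {A : Matrix (B4.Idx Λ N) (B4.Idx Λ N) ℝ}
    (hA : B4.Hyp56 Λ A γ₀ c₀ δ₀) {M : ℕ} (hM : 5 ≤ M) (hMR : kR d N γ₀ c₀ δ₀ < M)
    (hMθ : thetaConst d N γ₀ c₀ δ₀ < M) (hθW : thetaW d N γ₀ c₀ δ₀ M < 1) (ρ : ℝ) (x₁ x₂ : B4.Idx Λ N) :
    |cLoc (ldist (N := N) M) ρ (fun ω y₁ y₂ => latticeCw M Λ N A ω y₁ y₂) x₁ x₂|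
      ≤ 2 ^ d * γ₀⁻¹ * (1 - thetaW d N γ₀ c₀ δ₀ M)⁻¹ * Real.exp (δ₀ / 4)
          * Real.exp (-(δ₀ / 8) * sdist (N := N) M x₁ x₂) := by
  unfold cLoc
  rw [tsum_indicator_latticeCw_eq A {ω | Near (ldist (N := N) M) ρ ω x₁ x₂} x₁ x₂]
  refine ((abs_tsum_le_tsum_abs (summable_abs_indicator_term hγ hc hδ hA hM hMR hMθ _ x₁ x₂)).trans
    (abs_tsum_class_le_sdist hγ hc hδ hA hM hMR hMθ hθW _ x₁ x₂)).trans (le_of_eq ?_)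
  rw [mul_assoc (2 ^ d * γ₀⁻¹ * (1 - thetaW d N γ₀ c₀ δ₀ M)⁻¹), ← Real.exp_add]
  congr 2
  ring

/-- **(2.41) FOR THE `ℤ^d` OPERATORS OF [6]** — *"|C^{(k)}_Λ(u; x₁, x₂)| ≦ ce^{−c|x₁−x₂|}. (2.41)"* ("a random
walk expansion as in [6]"): through (2.42) (`BIJ88Eq242Lattice.eq242_lattice`) the whole walk sum gives
`|A_Λ^{−1}(x₁,x₂)| ≤ 2^dγ₀^{−1}(1 − θ_W)^{−1}e^{δ₀/4}·e^{−(δ₀/8)·sdist(x₁,x₂)}` (cf. [6] (5.7), certified for these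
operators by `B4Sect5Proof`/`B4Sect5WalkDecay` in lattice units; here in the walk-expansion form and label units).
[cite: BalabanImbrieJaffe1988, (2.41) p.264; Balaban1983RegularityDecay, (5.7) p.593] -/
theorem abs_inv_lattice_le (hγ : 0 < γ₀) (hc : 0 ≤ c₀) (hδ : 0 < δ₀) {A : Matrix (B4.Idx Λ N) (B4.Idx Λ N) ℝ}
    (hA : B4.Hyp56 Λ A γ₀ c₀ δ₀) {M : ℕ} (hM : 5 ≤ M) (hMR : kR d N γ₀ c₀ δ₀ < M)
    (hMθ : thetaConst d N γ₀ c₀ δ₀ < M) (hθW : thetaW d N γ₀ c₀ δ₀ M < 1) (x₁ x₂ : B4.Idx Λ N) :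
    |A⁻¹ x₁ x₂| ≤ 2 ^ d * γ₀⁻¹ * (1 - thetaW d N γ₀ c₀ δ₀ M)⁻¹ * Real.exp (δ₀ / 4)
          * Real.exp (-(δ₀ / 8) * sdist (N := N) M x₁ x₂) := by
  have h242 : ∑' ω, latticeCw M Λ N A ω x₁ x₂ = A⁻¹ x₁ x₂ :=
    (eq242_lattice hγ hc hδ hA hM hMR hMθ x₁ x₂).tsum_eq
  rw [← h242]
  have h := tsum_indicator_latticeCw_eq (N := N) A (Set.univ : Set (Walk ↥(labels M Λ))) x₁ x₂
  simp only [Set.indicator_univ] at h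
  rw [h]
  refine ((abs_tsum_le_tsum_abs (summable_abs_indicator_term hγ hc hδ hA hM hMR hMθ _ x₁ x₂)).trans
    (abs_tsum_class_le_sdist hγ hc hδ hA hM hMR hMθ hθW _ x₁ x₂)).trans (le_of_eq ?_)
  rw [mul_assoc (2 ^ d * γ₀⁻¹ * (1 - thetaW d N γ₀ c₀ δ₀ M)⁻¹), ← Real.exp_add]
  congr 2
  ring

/-- from a two-constant bound to r18's one-letter shape: `|K| ≤ K'e^{−κ·sd}` with `K' ≤ c ≤ κ`, `sd ≥ 0` gives
`|K| ≤ ce^{−c·sd}`. [cite: BalabanImbrieJaffe1988, (2.41) p.264] -/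
private theorem one_letter {K' κ c sd v : ℝ} (hv : |v| ≤ K' * Real.exp (-κ * sd)) (h1 : K' ≤ c) (h2 : c ≤ κ)
    (hsd : 0 ≤ sd) : |v| ≤ c * Real.exp (-c * sd) := by
  have hK' : 0 ≤ K' := by
    by_contra h
    push Not at h
    have : K' * Real.exp (-κ * sd) < 0 := mul_neg_of_neg_of_pos h (Real.exp_pos _)
    linarith [abs_nonneg v]
  have hc0 : 0 ≤ c := hK'.trans h1
  calc |v| ≤ K' * Real.exp (-κ * sd) := hv
    _ ≤ c * Real.exp (-κ * sd) := mul_le_mul_of_nonneg_right h1 (Real.exp_pos _).le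
    _ ≤ c * Real.exp (-c * sd) :=
        mul_le_mul_of_nonneg_left (Real.exp_le_exp.mpr (by nlinarith)) hc0

/-- **THE TYPED ROW (2.41)** `BIJ88Sect2Statements.Decay sdist A_Λ^{−1} c` for the `ℤ^d` operators of [6] (the
MATRIX inverse as a kernel), for every `c` compatible with the two explicit constants:
`2^dγ₀^{−1}(1 − θ_W)^{−1}e^{δ₀/4} ≤ c ≤ δ₀/8`. [cite: BalabanImbrieJaffe1988, (2.41) p.264] -/
theorem decay241_lattice (hγ : 0 < γ₀) (hc : 0 ≤ c₀) (hδ : 0 < δ₀) {A : Matrix (B4.Idx Λ N) (B4.Idx Λ N) ℝ}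
    (hA : B4.Hyp56 Λ A γ₀ c₀ δ₀) {M : ℕ} (hM : 5 ≤ M) (hMR : kR d N γ₀ c₀ δ₀ < M)
    (hMθ : thetaConst d N γ₀ c₀ δ₀ < M) (hθW : thetaW d N γ₀ c₀ δ₀ M < 1) {c : ℝ}
    (hc1 : 2 ^ d * γ₀⁻¹ * (1 - thetaW d N γ₀ c₀ δ₀ M)⁻¹ * Real.exp (δ₀ / 4) ≤ c) (hc2 : c ≤ δ₀ / 8) :
    BIJ88Sect2Statements.Decay (sdist (N := N) M) (fun x₁ x₂ => (A⁻¹ : Matrix (B4.Idx Λ N) (B4.Idx Λ N) ℝ) x₁ x₂)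
      c := fun x₁ x₂ =>
  one_letter (abs_inv_lattice_le hγ hc hδ hA hM hMR hMθ hθW x₁ x₂) hc1 hc2 (sdist_nonneg x₁ x₂)

/-- **THE TYPED ROW (2.43) «bounded as in (2.41)»** `BIJ88Sect2Statements.Decay sdist C_{Λ,loc} c` for the `ℤ^d`
operators of [6], every radius `ρ`, every compatible `c`. [cite: BalabanImbrieJaffe1988, (2.43) p.264] -/
theorem decay241_cLoc_lattice (hγ : 0 < γ₀) (hc : 0 ≤ c₀) (hδ : 0 < δ₀) {A : Matrix (B4.Idx Λ N) (B4.Idx Λ N) ℝ}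
    (hA : B4.Hyp56 Λ A γ₀ c₀ δ₀) {M : ℕ} (hM : 5 ≤ M) (hMR : kR d N γ₀ c₀ δ₀ < M)
    (hMθ : thetaConst d N γ₀ c₀ δ₀ < M) (hθW : thetaW d N γ₀ c₀ δ₀ M < 1) (ρ : ℝ) {c : ℝ}
    (hc1 : 2 ^ d * γ₀⁻¹ * (1 - thetaW d N γ₀ c₀ δ₀ M)⁻¹ * Real.exp (δ₀ / 4) ≤ c) (hc2 : c ≤ δ₀ / 8) :
    BIJ88Sect2Statements.Decay (sdist (N := N) M)
      (cLoc (ldist (N := N) M) ρ (fun ω y₁ y₂ => latticeCw M Λ N A ω y₁ y₂)) c := fun x₁ x₂ =>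
  one_letter (abs_cLoc_lattice_le hγ hc hδ hA hM hMR hMθ hθW ρ x₁ x₂) hc1 hc2 (sdist_nonneg x₁ x₂)

/-! ## §8 (2.39): the same rows for the Dirichlet restrictions `[A|_Λ]^{−1}`, same constants (v1.2) -/

/-- **(2.46) for the Dirichlet restrictions (2.39)** `C^{(k)}_Λ = [A|_Λ]^{−1}`, `Λ ⊆ Ω`, of an `A` on `L²(Ω; ℝ^N)`
with (5.6): the typed row `Ineq246` for `B4.compress hΛ A` with the SAME constants ((5.6) passes to compressions,
`B6GOmega.hyp56_compress`). [cite: BalabanImbrieJaffe1988, (2.39) p.264, (2.46) p.264] -/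
theorem ineq246_compress (hγ : 0 < γ₀) (hc : 0 ≤ c₀) (hδ : 0 < δ₀) {Ω : Finset (Fin d → ℤ)}
    {A : Matrix (B4.Idx Ω N) (B4.Idx Ω N) ℝ} (hA : B4.Hyp56 Ω A γ₀ c₀ δ₀) (hΛ : Λ ⊆ Ω) {M : ℕ} (hM : 5 ≤ M)
    (hMR : kR d N γ₀ c₀ δ₀ < M) (hMθ : thetaConst d N γ₀ c₀ δ₀ < M) (hθW : thetaW d N γ₀ c₀ δ₀ M < 1) {s : ℕ}
    (hs : 0 < s) (hlarge : K0 d N γ₀ c₀ δ₀ M ≤ Real.exp (δ₀ / (128 * 9 ^ d) * s)) :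
    BIJ88Sect2Statements.Ineq246 (fun X : Finset (Cubes M s Λ) => X.card)
      (memX (fun (x : B4.Idx Λ N) (l : ↥(labels M Λ)) => InBox M l.1 (x.1 : Fin d → ℤ)) (cubeOf M s) touch)
      (cX (ldist (N := N) M) ((s : ℝ) / 4) (cubeOf M s) touch
        (fun ω y₁ y₂ => latticeCw M Λ N (B4.compress hΛ A) ω y₁ y₂))
      (δ₀ / (128 * 9 ^ d)) s :=
  ineq246_lattice hγ hc hδ (B6GOmega.hyp56_compress hΛ hγ.le hc hδ.le hA) hM hMR hMθ hθW hs hlarge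

/-- **(2.47) for the Dirichlet restrictions (2.39)**, same constants. [cite: BalabanImbrieJaffe1988, (2.39) p.264,
(2.47) p.265] -/
theorem close247_compress (hγ : 0 < γ₀) (hc : 0 ≤ c₀) (hδ : 0 < δ₀) {Ω : Finset (Fin d → ℤ)}
    {A : Matrix (B4.Idx Ω N) (B4.Idx Ω N) ℝ} (hA : B4.Hyp56 Ω A γ₀ c₀ δ₀) (hΛ : Λ ⊆ Ω) {M : ℕ} (hM : 5 ≤ M)
    (hMR : kR d N γ₀ c₀ δ₀ < M) (hMθ : thetaConst d N γ₀ c₀ δ₀ < M) (hθW : thetaW d N γ₀ c₀ δ₀ M < 1) (ρ : ℝ) :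
    BIJ88Sect2Statements.Close (sdist (N := N) M)
      (cLoc (ldist (N := N) M) ρ (fun ω y₁ y₂ => latticeCw M Λ N (B4.compress hΛ A) ω y₁ y₂))
      (fun x₁ x₂ => ((B4.compress hΛ A)⁻¹ : Matrix (B4.Idx Λ N) (B4.Idx Λ N) ℝ) x₁ x₂)
      (2 ^ d * γ₀⁻¹ * (1 - thetaW d N γ₀ c₀ δ₀ M)⁻¹ * Real.exp (-(δ₀ / 16 * (ρ - 3)))) (δ₀ / 16) :=
  close247_lattice hγ hc hδ (B6GOmega.hyp56_compress hΛ hγ.le hc hδ.le hA) hM hMR hMθ hθW ρ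

/-- **(2.41) for the Dirichlet restrictions (2.39)**, same constants. [cite: BalabanImbrieJaffe1988, (2.39) p.264,
(2.41) p.264] -/
theorem decay241_compress (hγ : 0 < γ₀) (hc : 0 ≤ c₀) (hδ : 0 < δ₀) {Ω : Finset (Fin d → ℤ)}
    {A : Matrix (B4.Idx Ω N) (B4.Idx Ω N) ℝ} (hA : B4.Hyp56 Ω A γ₀ c₀ δ₀) (hΛ : Λ ⊆ Ω) {M : ℕ} (hM : 5 ≤ M)
    (hMR : kR d N γ₀ c₀ δ₀ < M) (hMθ : thetaConst d N γ₀ c₀ δ₀ < M) (hθW : thetaW d N γ₀ c₀ δ₀ M < 1) {c : ℝ}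
    (hc1 : 2 ^ d * γ₀⁻¹ * (1 - thetaW d N γ₀ c₀ δ₀ M)⁻¹ * Real.exp (δ₀ / 4) ≤ c) (hc2 : c ≤ δ₀ / 8) :
    BIJ88Sect2Statements.Decay (sdist (N := N) M)
      (fun x₁ x₂ => ((B4.compress hΛ A)⁻¹ : Matrix (B4.Idx Λ N) (B4.Idx Λ N) ℝ) x₁ x₂) c :=
  decay241_lattice hγ hc hδ (B6GOmega.hyp56_compress hΛ hγ.le hc hδ.le hA) hM hMR hMθ hθW hc1 hc2

/-- **(2.43) «bounded as in (2.41)» for the Dirichlet restrictions (2.39)**, same constants.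
[cite: BalabanImbrieJaffe1988, (2.39) p.264, (2.43) p.264] -/
theorem decay241_cLoc_compress (hγ : 0 < γ₀) (hc : 0 ≤ c₀) (hδ : 0 < δ₀) {Ω : Finset (Fin d → ℤ)}
    {A : Matrix (B4.Idx Ω N) (B4.Idx Ω N) ℝ} (hA : B4.Hyp56 Ω A γ₀ c₀ δ₀) (hΛ : Λ ⊆ Ω) {M : ℕ} (hM : 5 ≤ M)
    (hMR : kR d N γ₀ c₀ δ₀ < M) (hMθ : thetaConst d N γ₀ c₀ δ₀ < M) (hθW : thetaW d N γ₀ c₀ δ₀ M < 1) (ρ : ℝ)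
    {c : ℝ} (hc1 : 2 ^ d * γ₀⁻¹ * (1 - thetaW d N γ₀ c₀ δ₀ M)⁻¹ * Real.exp (δ₀ / 4) ≤ c) (hc2 : c ≤ δ₀ / 8) :
    BIJ88Sect2Statements.Decay (sdist (N := N) M)
      (cLoc (ldist (N := N) M) ρ (fun ω y₁ y₂ => latticeCw M Λ N (B4.compress hΛ A) ω y₁ y₂)) c :=
  decay241_cLoc_lattice hγ hc hδ (B6GOmega.hyp56_compress hΛ hγ.le hc hδ.le hA) hM hMR hMθ hθW ρ hc1 hc2

end Lattice

end Literature.MathematicalPhysics.QuantumFieldTheory.BalabanImbrieJaffe1984to88.BIJ88Ineq246Lattice
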